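import Mathlib.Analysis.Calculus.ImplicitContDiff
import Mathlib.Analysis.Calculus.Darboux
import Mathlib.Analysis.Calculus.Deriv.MeanValue
import Mathlib.Analysis.Calculus.Deriv.Prod
import Mathlib.Analysis.Calculus.Deriv.Comp
import Mathlib.Analysis.Normed.Module.FiniteDimension
import Mathlib.Analysis.SpecificLimits.Basic
import Mathlib.Topology.Order.IntermediateValue
import Mathlib.Data.Set.Card
import Mathlib.Data.Set.Finite.Lemmas
import Mathlib.Data.Sign.Defs
import Mathlib.LinearAlgebra.Matrix.NonsingularInverse
import Mathlib.LinearAlgebra.Matrix.Block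
import Mathlib.LinearAlgebra.Determinant
import Literature.ModelTheory.ExponentialFields.Wilkie1989Curves
import HarnessLib

/-!
# Wilkie 1989, §5: solution branches of `n - 1` equations in `ℝⁿ`; Lemmas 4 and 6 proved

Topic `Literature/ModelTheory/ExponentialFields`: the real-analytic input of §5 ("More results for
transfer", pp. 399–402) of A. J. Wilkie, *On the theory of the real exponential field*, Illinois
J. Math. 33 (1989), 384–408, on the way to the leaf
`Literature.ModelTheory.ExponentialFields.Wilkie1989_expAlgebraicPoints_mem` (`Wilkie1989.lean`,
§§5–6) of the decomposition of Wilkie's theorem.  The companion file `Wilkie1989Curves.lean`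
proves Lemma 5 and fixes coordinate notation (`SpaceCurve.zeroLocus`, `tailJacobian`, `gStar`,
`box`, `fibre`) in which it *states* Lemmas 4 and 6 in prose; this file **proves Lemmas 4 and 6**,
first in the coordinate-free product form `ℝⁿ = ℝ × E` described below (`ImplicitCurve.lemma4`,
`ImplicitCurve.lemma6`), and then, in the last section, in the coordinates of
`Wilkie1989Curves.lean` (`Wilkie1989_lemma4`, `Wilkie1989_lemma6`, next to that file's
`Wilkie1989_lemma5`): splitting off the first coordinate (`SpaceCurve.consCLM`, an isometry of sup
norms, `SpaceCurve.norm_cons`), `det (tailJacobian) ≠ 0` versus invertibility of `∂g/∂y`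
(`SpaceCurve.isRegular_prodSys`), and **`gStar = star`** (`SpaceCurve.gStar_eq_star`: Wilkie's
quotient of Jacobian determinants is the derivative along the branches, by a column reduction of
the bordered determinant).  Everything in this file is **proved**.

Setting (p. 399): `n ≥ 2`, `g₁, …, gₙ₋₁ : ℝⁿ → ℝ` continuously differentiable,
`V = {ᾱ ∈ ℝⁿ : gᵢ(ᾱ) = 0, i = 1, …, n - 1}`, and for each `ᾱ ∈ V`,
`det (∂(g₁, …, gₙ₋₁)/∂(x₂, …, xₙ))(ᾱ) ≠ 0`.  We write `ℝⁿ = ℝ × E` (`x₁` and `(x₂, …, xₙ)`),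
`g = (g₁, …, gₙ₋₁) : ℝ × E → E`, for a finite-dimensional real normed space `E`; the hypothesis
is `ImplicitCurve.IsRegular g` (the partial derivative `∂g/∂(x₂…xₙ)`, i.e.
`fderiv ℝ g v ∘L inr`, is invertible at every point of `V`).  Wilkie's `U_a` is the open ball
`{‖y‖ < a}` of `E` and `max {|αᵢ| : 1 ≤ i ≤ n}` is the (sup) norm of `ℝ × E`; for
`E = ℝⁿ⁻¹ = Fin (n-1) → ℝ` with its sup norm these are literally Wilkie's box and max.

* `ImplicitCurve.exists_branch` (**local structure**, implicit function theorem): near a point of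
  `V`, `V` is the graph of a `C¹` function of `x₁`.
* `ImplicitCurve.maxBranch` (**maximal solution branches** `t ↦ (t, φ(t))` of `g = 0` through a
  point, "the continuously differentiable functions `φᵢ : Iᵢ → ℝⁿ⁻¹`" of p. 400), uniqueness
  (`ImplicitCurve.eqOn_of_isPreconnected`), and the continuation principle
  `ImplicitCurve.mem_maxDom_of_frequently` (a branch which stays in a compact set extends).
* `ImplicitCurve.lemma5` (**Wilkie's Lemma 5**, p. 400), in the generality needed here: `a ≤ b`
  and derivatives merely non-vanishing (Darboux's theorem replaces the printed continuity of the
  derivatives, which `Wilkie1989_lemma5` of `Wilkie1989Curves.lean` assumes).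
* `ImplicitCurve.lemma4` (**Wilkie's Lemma 4**, pp. 399–400).  The printed hypothesis "`V` is the
  union of finitely many connected components" is **not needed**: the printed proof uses it only
  to have finitely many branches `φ₁, …, φₘ` at hand, and local compactness of `ℝⁿ` replaces this
  (an accumulation argument, `ImplicitCurve.exists_mem_of_forall_exists`).  This matters for the
  transfer to models of `T_exp` (p. 402: "Lemmas 4 and 6 are not immediately transferable …
  because of the connectedness hypothesis. However, all is well because of the following result
  of Khovanskii"): for Lemma 4 itself Khovanskii's theorem is thus not required (it is still
  required on p. 406 to bound the number of points of the slices `V ∩ ({a} × U_B)` uniformly in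
  parameters, so that "exactly `r` points" transfers).  The boxes in the conclusion are read as
  the printed proof and the use on p. 407 ("the `r` points of `V ∩ ({β₁} × Ū_B)` … (and these
  points are in `{β₁} × U_B` if `c < β₁ < d`)") dictate: the count is over the *closed* box
  `Ū_B` for `a ∈ [c, d]` (the same reading as in `Wilkie1989Curves.lean`, "Readings").
* `ImplicitCurve.lemma6` (**Wilkie's Lemma 6**, pp. 401–402): the number of zeros of `g` (here
  `h`) on `V ∩ ([c, d] × Ū_B)` is `r - |S(c)(+,+)| - |S(c)(-,-)| - |S(d)(+,-)| - |S(d)(-,+)|`,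
  with `g*` the derivative of `h` along the branches (`ImplicitCurve.star`; Wilkie's formula
  `∂g/∂x₁ - (∂g/∂x₂ … ∂g/∂xₙ) · (∂(g₁…gₙ₋₁)/∂(x₂…xₙ))⁻¹ · (∂g₁/∂x₁ … ∂gₙ₋₁/∂x₁)ᵀ` is
  `ImplicitCurve.star_eq`), "(The importance of the formula … will be that it makes no reference
  to any parameterization of the variety `V`.)" (p. 402).

## Mathlib search

Mathlib has the implicit function theorem in product form (`ContDiffAt.implicitFunction`,
`ContDiffAt.eventually_apply_eq_iff_implicitFunction`,
`ContDiffAt.hasStrictFDerivAt_implicitFunction`), Darboux's theorem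
(`hasDerivWithinAt_forall_lt_or_forall_gt_of_forall_ne`), strict monotonicity from the sign of the
derivative and the intermediate value theorem; it has no global theory of solution branches of an
implicit equation (maximal continuation), which is developed here.

## References

* A. J. Wilkie, *On the theory of the real exponential field*, Illinois J. Math. 33 (1989),
  384–408: §5, Lemma 4 (pp. 399–400), Lemma 5 (pp. 400–401), Lemma 6 (pp. 401–402).
-/

noncomputable section

open Set Filter Metric Topology Function
open scoped ContDiff

namespace Literature.ModelTheory.ExponentialFields

namespace ImplicitCurve

/-! ### Two topological preliminaries -/

section Prelim

variable {X : Type*} [TopologicalSpace X]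

/-- A nonempty, relatively open and relatively closed subset of a preconnected set is all of it.
[folklore] -/
theorem subset_of_relClopen {I A : Set X} (hI : IsPreconnected I) (hAI : A ⊆ I)
    (hne : A.Nonempty) (hopen : ∀ t ∈ A, ∃ N ∈ 𝓝 t, N ∩ I ⊆ A)
    (hclosed : ∀ t ∈ I, t ∈ closure A → t ∈ A) : I ⊆ A := by
  set U : Set X := interior (A ∪ Iᶜ) with hU
  have hAU : A ⊆ U := by
    intro t ht
    obtain ⟨N, hN, hNA⟩ := hopen t ht
    rw [hU, mem_interior_iff_mem_nhds]
    refine mem_of_superset hN fun x hx => ?_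
    by_cases hxI : x ∈ I
    · exact Or.inl (hNA ⟨hx, hxI⟩)
    · exact Or.inr hxI
  have hUI : U ∩ I ⊆ A := by
    rintro x ⟨hxU, hxI⟩
    rcases interior_subset hxU with h | h
    · exact h
    · exact (h hxI).elim
  have hcover : I ⊆ U ∪ (closure A)ᶜ := by
    intro t ht
    by_cases htc : t ∈ closure A
    · exact Or.inl (hAU (hclosed t ht htc))
    · exact Or.inr htc
  have hIU : (I ∩ U).Nonempty := by
    obtain ⟨a, ha⟩ := hne
    exact ⟨a, hAI ha, hAU ha⟩
  -- if `I` met `(closure A)ᶜ`, preconnectedness would give a point of `A` outside `closure A`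
  have hIV : ¬ (I ∩ (closure A)ᶜ).Nonempty := by
    intro hIV
    obtain ⟨x, hxI, hxU, hxV⟩ := hI U (closure A)ᶜ isOpen_interior isClosed_closure.isOpen_compl
      hcover hIU hIV
    exact hxV (subset_closure (hUI ⟨hxU, hxI⟩))
  intro t ht
  refine hclosed t ht ?_
  by_contra htc
  exact hIV ⟨t, ht, htc⟩

variable {E : Type*} [NormedAddCommGroup E]

/-- **Accumulation.** If a closed set `V ⊆ ℝ × E` contains, for every `δ > 0`, a point `v` with
`|v.1 - t₀| < δ`, `v.2` in a fixed compact set `C` and satisfying `Q`, then some point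
`(t₀, y) ∈ V`, `y ∈ C`, has `Q`-points of `V` in each of its neighbourhoods (local compactness
replaces the finiteness of the set of branches in Wilkie's proof of Lemma 4). [folklore] -/
theorem exists_mem_of_forall_exists {V : Set (ℝ × E)} (hV : IsClosed V) {C : Set E}
    (hC : IsCompact C) {t₀ : ℝ} {Q : ℝ × E → Prop}
    (h : ∀ δ > (0 : ℝ), ∃ v ∈ V, dist v.1 t₀ < δ ∧ v.2 ∈ C ∧ Q v) :
    ∃ y ∈ C, (t₀, y) ∈ V ∧ ∀ W ∈ 𝓝 (t₀, y), ∃ v ∈ W, v ∈ V ∧ Q v := by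
  choose v hvV hvt hvC hvQ using fun k : ℕ => h (1 / ((k : ℝ) + 1)) (by positivity)
  obtain ⟨y, hyC, φ, hφ, hlim⟩ := hC.tendsto_subseq fun k => hvC k
  have ht : Tendsto (fun k => (v (φ k)).1) atTop (𝓝 t₀) := by
    rw [tendsto_iff_dist_tendsto_zero]
    have h1 : Tendsto (fun k : ℕ => 1 / ((k : ℝ) + 1)) atTop (𝓝 0) :=
      tendsto_one_div_add_atTop_nhds_zero_nat
    refine squeeze_zero (fun k => dist_nonneg) (fun k => (hvt (φ k)).le) ?_
    exact h1.comp hφ.tendsto_atTop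
  have hv : Tendsto (fun k => v (φ k)) atTop (𝓝 (t₀, y)) := ht.prodMk_nhds hlim
  refine ⟨y, hyC, hV.mem_of_tendsto hv (Eventually.of_forall fun k => hvV (φ k)), ?_⟩
  intro W hW
  obtain ⟨k, hk⟩ := (hv.eventually_mem hW).exists
  exact ⟨v (φ k), hk, hvV (φ k), hvQ (φ k)⟩

/-- A set with `encard = r` is the range of an embedding of `Fin r`. [folklore] -/
theorem exists_embedding_of_encard_eq {α : Type*} {s : Set α} {r : ℕ} (h : s.encard = r) :
    ∃ y : Fin r ↪ α, range y = s := by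
  obtain ⟨n, f, hf⟩ := (finite_of_encard_eq_coe h).fin_embedding
  have hn : n = r := by
    have h1 : (range f).encard = n := by
      rw [← image_univ, f.injective.encard_image, encard_univ]; simp
    rw [hf, h] at h1
    exact_mod_cast h1.symm
  subst hn
  exact ⟨f, hf⟩

end Prelim

/-! ### Solution branches and maximal branches: definitions -/

section Defs

variable {E : Type*} [NormedAddCommGroup E]

/-- A **solution branch through `u`**: a continuous function `φ` on an open interval `dom ∋ u.1`
with `φ(u.1) = u.2` whose graph lies in `V = {g = 0}` (the functions `φᵢ : Iᵢ → ℝⁿ⁻¹` of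
Wilkie 1989, p. 400). [cite: Wilkie1989, proof of Lemma 4, p. 400] -/
structure Branch (g : ℝ × E → E) (u : ℝ × E) where
  /-- the domain, an open interval containing `u.1` -/
  dom : Set ℝ
  isOpen_dom : IsOpen dom
  isPreconnected_dom : IsPreconnected dom
  mem_dom : u.1 ∈ dom
  /-- the function -/
  toFun : ℝ → E
  continuousOn : ContinuousOn toFun dom
  apply_fst : toFun u.1 = u.2
  eq_zero : ∀ t ∈ dom, g (t, toFun t) = 0

/-- The domain of the **maximal solution branch** through `u`: the union of the domains of all
branches through `u` (the maximal interval `Iᵢ` of Wilkie 1989, p. 400). [cite: Wilkie1989, proof of Lemma 4, p. 400] -/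
def maxDom (g : ℝ × E → E) (u : ℝ × E) : Set ℝ :=
  ⋃ b : Branch g u, b.dom

open Classical in
/-- The **maximal solution branch** through `u` (the function `φᵢ : Iᵢ → ℝⁿ⁻¹` of Wilkie 1989,
p. 400), extended by the junk value `u.2` off `maxDom g u`. [cite: Wilkie1989, proof of Lemma 4, p. 400] -/
def maxBranch (g : ℝ × E → E) (u : ℝ × E) (t : ℝ) : E :=
  if h : ∃ b : Branch g u, t ∈ b.dom then h.choose.toFun t else u.2

variable {g : ℝ × E → E} {u : ℝ × E}

/-- Membership in the maximal domain. [folklore] -/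
theorem mem_maxDom_iff {t : ℝ} : t ∈ maxDom g u ↔ ∃ b : Branch g u, t ∈ b.dom := by
  simp [maxDom]

/-- The maximal domain is open. [folklore] -/
theorem isOpen_maxDom : IsOpen (maxDom g u) :=
  isOpen_iUnion fun b => b.isOpen_dom

/-- Every branch's domain is contained in the maximal domain. [folklore] -/
theorem Branch.dom_subset_maxDom (b : Branch g u) : b.dom ⊆ maxDom g u :=
  subset_iUnion (fun b : Branch g u => b.dom) b

/-- The maximal domain is nonempty iff there is a branch. [folklore] -/
theorem maxDom_nonempty_iff : (maxDom g u).Nonempty ↔ Nonempty (Branch g u) := by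
  constructor
  · rintro ⟨t, ht⟩
    obtain ⟨b, -⟩ := mem_maxDom_iff.1 ht
    exact ⟨b⟩
  · rintro ⟨b⟩
    exact ⟨u.1, b.dom_subset_maxDom b.mem_dom⟩

/-- The maximal domain is an interval. [folklore] -/
theorem isPreconnected_maxDom : IsPreconnected (maxDom g u) := by
  by_cases hne : Nonempty (Branch g u)
  · exact isPreconnected_iUnion (s := fun b : Branch g u => b.dom)
      ⟨u.1, mem_iInter.2 fun b => b.mem_dom⟩ fun b => b.isPreconnected_dom
  · have : maxDom g u = ∅ := by
      rw [maxDom, iUnion_eq_empty]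
      intro b
      exact (hne ⟨b⟩).elim
    rw [this]
    exact isPreconnected_empty

/-- The maximal domain is order-connected. [folklore] -/
theorem ordConnected_maxDom : (maxDom g u).OrdConnected :=
  isPreconnected_maxDom.ordConnected

end Defs

/-! ### The setting: a regular system `g : ℝ × E → E` -/

variable {E : Type*} [NormedAddCommGroup E] [NormedSpace ℝ E] [FiniteDimensional ℝ E]

/-- **The standing hypothesis of Lemmas 4 and 6** (Wilkie 1989, p. 399 and p. 401): `g` is
continuously differentiable and at every point of `V = {g = 0}` the partial derivative of `g` in
the direction of `E` (the Jacobian `∂(g₁, …, gₙ₋₁)/∂(x₂, …, xₙ)`) is invertible. [cite: Wilkie1989, Lemma 4 (hypotheses), p. 399] -/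
structure IsRegular (g : ℝ × E → E) : Prop where
  contDiff : ContDiff ℝ 1 g
  isInvertible : ∀ v, g v = 0 → (fderiv ℝ g v ∘L ContinuousLinearMap.inr ℝ ℝ E).IsInvertible

/-- The slope `-(∂g/∂y)⁻¹ (∂g/∂x₁)` of the solution branches of `g = 0` at `v` (implicit
differentiation). [folklore] -/
def tangentSlope (g : ℝ × E → E) (v : ℝ × E) : E :=
  -((fderiv ℝ g v ∘L ContinuousLinearMap.inr ℝ ℝ E).inverse (fderiv ℝ g v (1, 0)))

variable {g : ℝ × E → E}

omit [FiniteDimensional ℝ E] in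
/-- The zero set `V` of a regular system is closed. [folklore] -/
theorem IsRegular.isClosed (hg : IsRegular g) : IsClosed {v : ℝ × E | g v = 0} :=
  isClosed_eq hg.contDiff.continuous continuous_const

/-! ### Solution branches -/

/-- **Local structure of `V`** (implicit function theorem): through every point `u` of `V` there
is a solution branch `φ`, differentiable at `u.1` with slope `tangentSlope g u`, and near `u` the
set `V` *is* the graph of `φ` ("Using the implicit function theorem …", Wilkie 1989, p. 399).
[cite: Wilkie1989, proof of Lemma 4, pp. 399–400] -/
theorem exists_branch (hg : IsRegular g) {u : ℝ × E} (hu : g u = 0) :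
    ∃ b : Branch g u, (∀ᶠ v in 𝓝 u, g v = 0 ↔ b.toFun v.1 = v.2) ∧
      HasDerivAt b.toFun (tangentSlope g u) u.1 := by
  have cdf : ContDiffAt ℝ 1 g u := hg.contDiff.contDiffAt
  have pn : (1 : ℕ∞ω) ≠ 0 := one_ne_zero
  have if₂ := hg.isInvertible u hu
  set ψ := cdf.implicitFunction pn if₂ with hψ
  have hψu : ψ u.1 = u.2 := cdf.implicitFunction_apply_self pn if₂
  have hiff : ∀ᶠ v in 𝓝 u, g v = 0 ↔ ψ v.1 = v.2 := by
    have := cdf.eventually_apply_eq_iff_implicitFunction pn if₂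
    rw [hu] at this
    exact this
  have hsol : ∀ᶠ t in 𝓝 u.1, g (t, ψ t) = 0 := by
    have := cdf.eventually_apply_implicitFunction pn if₂
    rw [hu] at this
    exact this
  have hcd : ContDiffAt ℝ 1 ψ u.1 := cdf.contDiffAt_implicitFunction pn if₂
  have hcont : ∀ᶠ t in 𝓝 u.1, ContinuousAt ψ t :=
    (hcd.eventually (by simp)).mono fun t ht => ht.continuousAt
  obtain ⟨ε, hε, hball⟩ := Metric.eventually_nhds_iff_ball.1 (hsol.and hcont)
  have hderiv : HasDerivAt ψ (tangentSlope g u) u.1 := by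
    have h1 := (cdf.hasStrictFDerivAt_implicitFunction pn if₂).hasFDerivAt.hasDerivAt
    refine h1.congr_deriv ?_
    simp [tangentSlope]
  refine ⟨⟨ball u.1 ε, isOpen_ball, (convex_ball u.1 ε).isPreconnected, mem_ball_self hε, ψ,
    fun t ht => (hball t ht).2.continuousWithinAt, hψu, fun t ht => (hball t ht).1⟩, hiff, hderiv⟩

/-- **Uniqueness of continuation**: two continuous solutions of `g(t, φ(t)) = 0` on a preconnected
set of times which agree at one time agree at all times (the local uniqueness clause of the
implicit function theorem, propagated along the interval). [folklore] -/
theorem eqOn_of_isPreconnected (hg : IsRegular g) {I : Set ℝ} (hI : IsPreconnected I)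
    {φ₁ φ₂ : ℝ → E} (h₁ : ContinuousOn φ₁ I) (h₂ : ContinuousOn φ₂ I)
    (hV₁ : ∀ t ∈ I, g (t, φ₁ t) = 0) (hV₂ : ∀ t ∈ I, g (t, φ₂ t) = 0)
    {t₀ : ℝ} (ht₀ : t₀ ∈ I) (he : φ₁ t₀ = φ₂ t₀) : EqOn φ₁ φ₂ I := by
  let A : Set ℝ := {t ∈ I | φ₁ t = φ₂ t}
  have hAI : A ⊆ I := fun t ht => ht.1
  suffices I ⊆ A from fun t ht => (this ht).2
  refine subset_of_relClopen hI hAI ⟨t₀, ht₀, he⟩ (fun t ht => ?_) (fun t htI htc => ?_)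
  · -- relatively open: near `(t, φ₁ t)` the zero set is a graph
    obtain ⟨b, hb, -⟩ := exists_branch hg (hV₁ t ht.1)
    have hT₁ : ∀ᶠ s in 𝓝[I] t, (g (s, φ₁ s) = 0 ↔ b.toFun s = φ₁ s) := by
      have hc : Tendsto (fun s => (s, φ₁ s)) (𝓝[I] t) (𝓝 (t, φ₁ t)) :=
        (continuousWithinAt_id.prodMk (h₁ t ht.1)).tendsto
      exact hc.eventually hb
    have hT₂ : ∀ᶠ s in 𝓝[I] t, (g (s, φ₂ s) = 0 ↔ b.toFun s = φ₂ s) := by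
      have hc : Tendsto (fun s => (s, φ₂ s)) (𝓝[I] t) (𝓝 (t, φ₁ t)) := by
        rw [ht.2]
        exact (continuousWithinAt_id.prodMk (h₂ t ht.1)).tendsto
      exact hc.eventually hb
    have hmem : ∀ᶠ s in 𝓝[I] t, s ∈ I := eventually_mem_nhdsWithin
    have key : ∀ᶠ s in 𝓝[I] t, s ∈ A := by
      filter_upwards [hT₁, hT₂, hmem] with s hs0 hs1 hsI
      exact ⟨hsI, ((hs0.1 (hV₁ s hsI)).symm.trans (hs1.1 (hV₂ s hsI)))⟩
    rw [eventually_nhdsWithin_iff] at key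
    obtain ⟨N, hN, hNA⟩ := key.exists_mem
    exact ⟨N, hN, fun s hs => hNA s hs.1 hs.2⟩
  · -- relatively closed: limits within `A`
    refine ⟨htI, ?_⟩
    haveI : (𝓝[A] t).NeBot := mem_closure_iff_nhdsWithin_neBot.1 htc
    have c₁ : Tendsto φ₁ (𝓝[A] t) (𝓝 (φ₁ t)) := ((h₁ t htI).mono hAI).tendsto
    have c₂ : Tendsto φ₂ (𝓝[A] t) (𝓝 (φ₂ t)) := ((h₂ t htI).mono hAI).tendsto
    have heq : φ₁ =ᶠ[𝓝[A] t] φ₂ :=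
      (eventually_mem_nhdsWithin (a := t) (s := A)).mono fun s hs => hs.2
    exact tendsto_nhds_unique_of_eventuallyEq c₁ c₂ heq

namespace Branch

variable {u : ℝ × E}

/-- Two branches through the same point agree on the intersection of their domains. [folklore] -/
theorem eqOn_inter (hg : IsRegular g) (b₁ b₂ : Branch g u) :
    EqOn b₁.toFun b₂.toFun (b₁.dom ∩ b₂.dom) := by
  have hI : IsPreconnected (b₁.dom ∩ b₂.dom) := by
    rw [isPreconnected_iff_ordConnected]
    exact b₁.isPreconnected_dom.ordConnected.inter b₂.isPreconnected_dom.ordConnected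
  exact eqOn_of_isPreconnected hg hI (b₁.continuousOn.mono inter_subset_left)
    (b₂.continuousOn.mono inter_subset_right) (fun t ht => b₁.eq_zero t ht.1)
    (fun t ht => b₂.eq_zero t ht.2) ⟨b₁.mem_dom, b₂.mem_dom⟩
    (b₁.apply_fst.trans b₂.apply_fst.symm)

end Branch

/-! ### Maximal branches -/

section MaxBranch

variable {u : ℝ × E}

/-- The maximal branch extends every branch. [folklore] -/
theorem maxBranch_eq (hg : IsRegular g) (b : Branch g u) {t : ℝ} (ht : t ∈ b.dom) :
    maxBranch g u t = b.toFun t := by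
  classical
  have h : ∃ b : Branch g u, t ∈ b.dom := ⟨b, ht⟩
  rw [maxBranch, dif_pos h]
  exact Branch.eqOn_inter hg h.choose b ⟨h.choose_spec, ht⟩

/-- The base time lies in the maximal domain. [folklore] -/
theorem mem_maxDom (hg : IsRegular g) (hu : g u = 0) : u.1 ∈ maxDom g u := by
  obtain ⟨b, -, -⟩ := exists_branch hg hu
  exact b.dom_subset_maxDom b.mem_dom

/-- The maximal branch passes through the base point. [folklore] -/
theorem maxBranch_apply_fst (hg : IsRegular g) (hu : g u = 0) : maxBranch g u u.1 = u.2 := by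
  obtain ⟨b, -, -⟩ := exists_branch hg hu
  rw [maxBranch_eq hg b b.mem_dom, b.apply_fst]

/-- The graph of the maximal branch lies in `V`. [folklore] -/
theorem maxBranch_eq_zero (hg : IsRegular g) {t : ℝ} (ht : t ∈ maxDom g u) :
    g (t, maxBranch g u t) = 0 := by
  obtain ⟨b, hb⟩ := mem_maxDom_iff.1 ht
  rw [maxBranch_eq hg b hb]
  exact b.eq_zero t hb

/-- Near a point of a branch's domain the maximal branch is that branch. [folklore] -/
theorem maxBranch_eventuallyEq (hg : IsRegular g) (b : Branch g u) {t : ℝ} (ht : t ∈ b.dom) :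
    maxBranch g u =ᶠ[𝓝 t] b.toFun :=
  eventually_of_mem (b.isOpen_dom.mem_nhds ht) fun _ hs => maxBranch_eq hg b hs

/-- The maximal branch is continuous on its domain (pointwise form). [folklore] -/
theorem continuousAt_maxBranch (hg : IsRegular g) {t : ℝ} (ht : t ∈ maxDom g u) :
    ContinuousAt (maxBranch g u) t := by
  obtain ⟨b, hb⟩ := mem_maxDom_iff.1 ht
  exact ((b.continuousOn t hb).continuousAt (b.isOpen_dom.mem_nhds hb)).congr
    (maxBranch_eventuallyEq hg b hb).symm

/-- The maximal branch is continuous on its domain. [folklore] -/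
theorem continuousOn_maxBranch (hg : IsRegular g) : ContinuousOn (maxBranch g u) (maxDom g u) :=
  fun _ ht => (continuousAt_maxBranch hg ht).continuousWithinAt

/-- The maximal branch, as a branch. [folklore] -/
def maxBranchAsBranch (hg : IsRegular g) (hu : g u = 0) : Branch g u where
  dom := maxDom g u
  isOpen_dom := isOpen_maxDom
  isPreconnected_dom := isPreconnected_maxDom
  mem_dom := mem_maxDom hg hu
  toFun := maxBranch g u
  continuousOn := continuousOn_maxBranch hg
  apply_fst := maxBranch_apply_fst hg hu
  eq_zero := fun _ ht => maxBranch_eq_zero hg ht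

/-- **Local uniqueness around the maximal branch**: near a point of its graph, the zero set of `g`
is contained in the graph. [folklore] -/
theorem eventually_graph (hg : IsRegular g) {t : ℝ} (ht : t ∈ maxDom g u) :
    ∀ᶠ v in 𝓝 (t, maxBranch g u t), g v = 0 → v.1 ∈ maxDom g u ∧ v.2 = maxBranch g u v.1 := by
  obtain ⟨b, hb, -⟩ := exists_branch hg (maxBranch_eq_zero hg ht)
  -- near `t`, the maximal branch agrees with `b`
  have h1 : ∀ᶠ s in 𝓝 t, s ∈ maxDom g u ∧ b.toFun s = maxBranch g u s := by
    have hc : ContinuousAt (fun s => (s, maxBranch g u s)) t :=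
      continuousAt_id.prodMk (continuousAt_maxBranch hg ht)
    have h2 : ∀ᶠ s in 𝓝 t, (g (s, maxBranch g u s) = 0 ↔ b.toFun s = maxBranch g u s) :=
      hc.eventually hb
    filter_upwards [h2, isOpen_maxDom.mem_nhds ht] with s hs hsD
    exact ⟨hsD, hs.1 (maxBranch_eq_zero hg hsD)⟩
  have h1' : ∀ᶠ v in 𝓝 (t, maxBranch g u t), v.1 ∈ maxDom g u ∧ b.toFun v.1 = maxBranch g u v.1 :=
    (continuous_fst.tendsto (t, maxBranch g u t)).eventually h1
  filter_upwards [hb, h1'] with v hv hv' hv0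
  exact ⟨hv'.1, ((hv.1 hv0).symm.trans hv'.2)⟩

/-- The maximal branch is differentiable, with the slope given by implicit differentiation.
[folklore] -/
theorem hasDerivAt_maxBranch (hg : IsRegular g) {t : ℝ} (ht : t ∈ maxDom g u) :
    HasDerivAt (maxBranch g u) (tangentSlope g (t, maxBranch g u t)) t := by
  obtain ⟨b, hb, hd⟩ := exists_branch hg (maxBranch_eq_zero hg ht)
  refine HasDerivAt.congr_of_eventuallyEq hd ?_
  -- `maxBranch g u = b.toFun` near `t`
  have hc : ContinuousAt (fun s => (s, maxBranch g u s)) t :=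
    continuousAt_id.prodMk (continuousAt_maxBranch hg ht)
  have h2 : ∀ᶠ s in 𝓝 t, (g (s, maxBranch g u s) = 0 ↔ b.toFun s = maxBranch g u s) :=
    hc.eventually hb
  filter_upwards [h2, isOpen_maxDom.mem_nhds ht] with s hs hsD
  exact (hs.1 (maxBranch_eq_zero hg hsD)).symm

/-- Distinct maximal branches have disjoint graphs: if the maximal branches through `u` and `u'`
meet over a common time then they have the same value at `u.1` (so `u` lies on both).
[folklore] -/
theorem maxBranch_apply_eq_of_eq (hg : IsRegular g) {u' : ℝ × E} (hu : g u = 0) {t : ℝ}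
    (ht : t ∈ maxDom g u) (ht' : t ∈ maxDom g u') (he : maxBranch g u t = maxBranch g u' t)
    (h1 : u.1 ∈ maxDom g u') : maxBranch g u' u.1 = u.2 := by
  have hI : IsPreconnected (maxDom g u ∩ maxDom g u') := by
    rw [isPreconnected_iff_ordConnected]
    exact ordConnected_maxDom.inter ordConnected_maxDom
  have := eqOn_of_isPreconnected hg hI ((continuousOn_maxBranch hg).mono inter_subset_left)
    ((continuousOn_maxBranch hg).mono inter_subset_right)
    (fun s hs => maxBranch_eq_zero hg hs.1) (fun s hs => maxBranch_eq_zero hg hs.2) ⟨ht, ht'⟩ he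
  rw [← maxBranch_apply_fst hg hu]
  exact (this ⟨mem_maxDom hg hu, h1⟩).symm

/-- **Continuation principle** ("note that `lim_{t → d'⁻} φᵢ(t)` certainly exists … and this point
must lie in `V` (since `V` is closed). It clearly follows that `d' ∈ Iᵢ`", Wilkie 1989, p. 400):
if the maximal branch through `u` takes values in a fixed compact set at times accumulating at
`b`, then `b` is in its domain. [cite: Wilkie1989, proof of Lemma 4, p. 400] -/
theorem mem_maxDom_of_frequently (hg : IsRegular g) (hu : g u = 0) {C : Set E} (hC : IsCompact C)
    {b : ℝ} (hfr : ∃ᶠ t in 𝓝 b, t ∈ maxDom g u ∧ maxBranch g u t ∈ C) : b ∈ maxDom g u := by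
  -- a limit point `(b, y)` of the graph, `y ∈ C`
  have hacc : ∀ δ > (0 : ℝ), ∃ v ∈ {v : ℝ × E | g v = 0}, dist v.1 b < δ ∧ v.2 ∈ C ∧
      (v.1 ∈ maxDom g u ∧ v.2 = maxBranch g u v.1) := by
    intro δ hδ
    obtain ⟨t, ⟨htD, htC⟩, ht⟩ := (hfr.and_eventually (ball_mem_nhds b hδ)).exists
    exact ⟨(t, maxBranch g u t), maxBranch_eq_zero hg htD, ht, htC, htD, rfl⟩
  obtain ⟨y, -, hyV, hW⟩ := exists_mem_of_forall_exists hg.isClosed hC hacc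
  -- the local branch at `(b, y)`
  obtain ⟨bb, hbb, -⟩ := exists_branch hg hyV
  -- a graph point inside the uniqueness neighbourhood, over a time in `bb.dom`
  have hN : {v : ℝ × E | (g v = 0 ↔ bb.toFun v.1 = v.2)} ∩ Prod.fst ⁻¹' bb.dom ∈ 𝓝 (b, y) :=
    inter_mem hbb ((continuous_fst.tendsto (b, y)).eventually
      (bb.isOpen_dom.mem_nhds bb.mem_dom) |> fun h => h)
  obtain ⟨v, ⟨hv1, hv2⟩, hvV, hvD, hvB⟩ := hW _ hN
  -- `maxBranch` and `bb` agree on `maxDom ∩ bb.dom`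
  have hI : IsPreconnected (maxDom g u ∩ bb.dom) := by
    rw [isPreconnected_iff_ordConnected]
    exact ordConnected_maxDom.inter bb.isPreconnected_dom.ordConnected
  have hagree : EqOn (maxBranch g u) bb.toFun (maxDom g u ∩ bb.dom) :=
    eqOn_of_isPreconnected hg hI ((continuousOn_maxBranch hg).mono inter_subset_left)
      (bb.continuousOn.mono inter_subset_right) (fun s hs => maxBranch_eq_zero hg hs.1)
      (fun s hs => bb.eq_zero s hs.2) ⟨hvD, hv2⟩ (hvB ▸ ((hv1.1 hvV).symm))
  -- glue: a branch through `u` on `maxDom ∪ bb.dom`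
  classical
  let φ : ℝ → E := fun s => if s ∈ maxDom g u then maxBranch g u s else bb.toFun s
  have hφD : ∀ s ∈ maxDom g u, φ s = maxBranch g u s := fun s hs => by simp [φ, hs]
  have hφB : ∀ s ∈ bb.dom, φ s = bb.toFun s := by
    intro s hs
    by_cases hsD : s ∈ maxDom g u
    · rw [hφD s hsD]; exact hagree ⟨hsD, hs⟩
    · simp [φ, hsD]
  let B : Branch g u :=
    { dom := maxDom g u ∪ bb.dom
      isOpen_dom := isOpen_maxDom.union bb.isOpen_dom
      isPreconnected_dom := IsPreconnected.union' ⟨v.1, hvD, hv2⟩ isPreconnected_maxDom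
        bb.isPreconnected_dom
      mem_dom := Or.inl (mem_maxDom hg hu)
      toFun := φ
      continuousOn := by
        intro s hs
        rcases hs with hs | hs
        · refine ContinuousAt.continuousWithinAt ?_
          refine (continuousAt_maxBranch hg hs).congr ?_
          exact eventually_of_mem (isOpen_maxDom.mem_nhds hs) fun s' hs' => (hφD s' hs').symm
        · refine ContinuousAt.continuousWithinAt ?_
          have hc : ContinuousAt bb.toFun s :=
            (bb.continuousOn s hs).continuousAt (bb.isOpen_dom.mem_nhds hs)
          refine hc.congr ?_
          exact eventually_of_mem (bb.isOpen_dom.mem_nhds hs) fun s' hs' => (hφB s' hs').symm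
      apply_fst := by rw [hφD _ (mem_maxDom hg hu), maxBranch_apply_fst hg hu]
      eq_zero := by
        intro s hs
        by_cases hsD : s ∈ maxDom g u
        · rw [hφD s hsD]; exact maxBranch_eq_zero hg hsD
        · rw [hφB s (hs.resolve_left hsD)]; exact bb.eq_zero s (hs.resolve_left hsD) }
  exact B.dom_subset_maxDom (Or.inr bb.mem_dom)

/-- Continuation to the right end of an interval on which the branch stays in a compact set.
[cite: Wilkie1989, proof of Lemma 4, p. 400] -/
theorem mem_maxDom_of_Ico (hg : IsRegular g) (hu : g u = 0) {C : Set E} (hC : IsCompact C)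
    {a b : ℝ} (hab : a < b) (hsub : Ico a b ⊆ maxDom g u)
    (hin : ∀ t ∈ Ico a b, maxBranch g u t ∈ C) : b ∈ maxDom g u := by
  refine mem_maxDom_of_frequently hg hu hC ?_
  have hfr : ∃ᶠ t in 𝓝 b, t ∈ Ico a b := by
    rw [← mem_closure_iff_frequently, closure_Ico hab.ne]
    exact right_mem_Icc.2 hab.le
  exact hfr.mono fun t ht => ⟨hsub ht, hin t ht⟩

/-- Continuation to the left end. [cite: Wilkie1989, proof of Lemma 4, p. 400] -/
theorem mem_maxDom_of_Ioc (hg : IsRegular g) (hu : g u = 0) {C : Set E} (hC : IsCompact C)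
    {a b : ℝ} (hab : a < b) (hsub : Ioc a b ⊆ maxDom g u)
    (hin : ∀ t ∈ Ioc a b, maxBranch g u t ∈ C) : a ∈ maxDom g u := by
  refine mem_maxDom_of_frequently hg hu hC ?_
  have hfr : ∃ᶠ t in 𝓝 a, t ∈ Ioc a b := by
    rw [← mem_closure_iff_frequently, closure_Ioc hab.ne]
    exact left_mem_Icc.2 hab.le
  exact hfr.mono fun t ht => ⟨hsub ht, hin t ht⟩

end MaxBranch

/-! ### Lemma 5: counting zeros of monotone functions by signs at the end points -/

section Lemma5

/-- **Wilkie 1989, Lemma 5** (pp. 400–401). "Suppose that `r ∈ ℕ`, `r ≥ 1`, and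
`f₁, …, f_r : [a, b] → ℝ` (`a, b ∈ ℝ`, `a < b`) have continuous non-vanishing derivatives
throughout `[a, b]`. For `σ, τ ∈ {+, -}` and `x ∈ [a, b]` define
`S(σ, τ, x) = {i : 1 ≤ i ≤ r, fᵢ(x) is σ've and fᵢ'(x) is τ've}`. Let
`Z = {i : 1 ≤ i ≤ r, fᵢ has a zero in [a, b]}`. Then
`|Z| = r - |S(+,+,a)| - |S(-,-,a)| - |S(+,-,b)| - |S(-,+,b)|`."  Here with the weaker
hypotheses `a ≤ b`, any `r`, and derivatives (within `[a, b]`) merely non-vanishing (Darboux's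
theorem replaces continuity), and the identity written additively in `ℕ`; this generalizes
`Wilkie1989_lemma5` (`Wilkie1989Curves.lean`, which keeps the printed `a < b` and the continuity
of the derivatives) and is the form used in the proof of Lemma 6 below, where the derivatives
`g*` along the branches are not a priori continuous. [cite: Wilkie1989, Lemma 5] -/
theorem lemma5 {r : ℕ} {a b : ℝ} (hab : a ≤ b) (f f' : Fin r → ℝ → ℝ)
    (hf : ∀ i, ∀ x ∈ Icc a b, HasDerivWithinAt (f i) (f' i x) (Icc a b) x)
    (hf' : ∀ i, ∀ x ∈ Icc a b, f' i x ≠ 0)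
    [DecidablePred fun i => ∃ x ∈ Icc a b, f i x = 0] :
    (Finset.univ.filter fun i => ∃ x ∈ Icc a b, f i x = 0).card
      + (Finset.univ.filter fun i => 0 < f i a ∧ 0 < f' i a).card
      + (Finset.univ.filter fun i => f i a < 0 ∧ f' i a < 0).card
      + (Finset.univ.filter fun i => 0 < f i b ∧ f' i b < 0).card
      + (Finset.univ.filter fun i => f i b < 0 ∧ 0 < f' i b).card = r := by
  classical
  have ha : a ∈ Icc a b := left_mem_Icc.2 hab
  have hb : b ∈ Icc a b := right_mem_Icc.2 hab
  -- pointwise: exactly one of the five conditions holds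
  have key : ∀ i, (if (∃ x ∈ Icc a b, f i x = 0) then 1 else 0)
      + (if (0 < f i a ∧ 0 < f' i a) then 1 else 0) + (if (f i a < 0 ∧ f' i a < 0) then 1 else 0)
      + (if (0 < f i b ∧ f' i b < 0) then 1 else 0)
      + (if (f i b < 0 ∧ 0 < f' i b) then 1 else 0) = (1 : ℕ) := by
    intro i
    have hcont : ContinuousOn (f i) (Icc a b) := fun x hx => (hf i x hx).continuousWithinAt
    have hderiv : ∀ x ∈ interior (Icc a b), deriv (f i) x = f' i x := by
      intro x hx
      rw [interior_Icc] at hx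
      exact ((hf i x (Ioo_subset_Icc_self hx)).hasDerivAt (Icc_mem_nhds hx.1 hx.2)).deriv
    rcases hasDerivWithinAt_forall_lt_or_forall_gt_of_forall_ne (convex_Icc a b) (hf i) (hf' i)
      with hneg | hpos
    · -- `fᵢ' < 0`: strictly decreasing
      have hanti : StrictAntiOn (f i) (Icc a b) :=
        strictAntiOn_of_deriv_neg (convex_Icc a b) hcont fun x hx => by
          rw [hderiv x hx]
          rw [interior_Icc] at hx
          exact hneg x (Ioo_subset_Icc_self hx)
      have h1 : f' i a < 0 := hneg a ha
      have h2 : f' i b < 0 := hneg b hb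
      have hzero : (∃ x ∈ Icc a b, f i x = 0) ↔ (0 ≤ f i a ∧ f i b ≤ 0) := by
        constructor
        · rintro ⟨x, hx, hx0⟩
          exact ⟨hx0 ▸ hanti.antitoneOn ha hx hx.1, hx0 ▸ hanti.antitoneOn hx hb hx.2⟩
        · rintro ⟨h0a, hb0⟩
          obtain ⟨x, hx, hx0⟩ := intermediate_value_Icc' hab hcont ⟨hb0, h0a⟩
          exact ⟨x, hx, hx0⟩
      rcases lt_or_ge (f i a) 0 with hfa | hfa
      · have hfb : f i b < 0 := lt_of_le_of_lt (hanti.antitoneOn ha hb hab) hfa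
        have hZ : ¬ ∃ x ∈ Icc a b, f i x = 0 := fun h => absurd (hzero.1 h).1 (not_le.2 hfa)
        rw [if_neg hZ, if_neg fun h => lt_asymm hfa h.1, if_pos ⟨hfa, h1⟩,
          if_neg fun h => lt_asymm hfb h.1, if_neg fun h => lt_asymm h2 h.2]
      · rcases lt_or_ge 0 (f i b) with hfb | hfb
        · have hfa' : 0 < f i a := lt_of_lt_of_le hfb (hanti.antitoneOn ha hb hab)
          have hZ : ¬ ∃ x ∈ Icc a b, f i x = 0 := fun h => absurd (hzero.1 h).2 (not_le.2 hfb)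
          rw [if_neg hZ, if_neg fun h => lt_asymm h1 h.2, if_neg fun h => lt_asymm hfa' h.1,
            if_pos ⟨hfb, h2⟩, if_neg fun h => lt_asymm hfb h.1]
        · have hZ : ∃ x ∈ Icc a b, f i x = 0 := hzero.2 ⟨hfa, hfb⟩
          rw [if_pos hZ, if_neg fun h => lt_asymm h1 h.2, if_neg fun h => not_lt.2 hfa h.1,
            if_neg fun h => not_lt.2 hfb h.1, if_neg fun h => lt_asymm h2 h.2]
    · -- `fᵢ' > 0`: strictly increasing
      have hmono : StrictMonoOn (f i) (Icc a b) :=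
        strictMonoOn_of_deriv_pos (convex_Icc a b) hcont fun x hx => by
          rw [hderiv x hx]
          rw [interior_Icc] at hx
          exact hpos x (Ioo_subset_Icc_self hx)
      have h1 : 0 < f' i a := hpos a ha
      have h2 : 0 < f' i b := hpos b hb
      have hzero : (∃ x ∈ Icc a b, f i x = 0) ↔ (f i a ≤ 0 ∧ 0 ≤ f i b) := by
        constructor
        · rintro ⟨x, hx, hx0⟩
          exact ⟨hx0 ▸ hmono.monotoneOn ha hx hx.1, hx0 ▸ hmono.monotoneOn hx hb hx.2⟩
        · rintro ⟨ha0, h0b⟩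
          obtain ⟨x, hx, hx0⟩ := intermediate_value_Icc hab hcont ⟨ha0, h0b⟩
          exact ⟨x, hx, hx0⟩
      rcases lt_or_ge 0 (f i a) with hfa | hfa
      · have hfb : 0 < f i b := lt_of_lt_of_le hfa (hmono.monotoneOn ha hb hab)
        have hZ : ¬ ∃ x ∈ Icc a b, f i x = 0 := fun h => absurd (hzero.1 h).1 (not_le.2 hfa)
        rw [if_neg hZ, if_pos ⟨hfa, h1⟩, if_neg fun h => lt_asymm hfa h.1,
          if_neg fun h => lt_asymm h2 h.2, if_neg fun h => lt_asymm hfb h.1]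
      · rcases lt_or_ge (f i b) 0 with hfb | hfb
        · have hfa' : f i a < 0 := lt_of_le_of_lt (hmono.monotoneOn ha hb hab) hfb
          have hZ : ¬ ∃ x ∈ Icc a b, f i x = 0 := fun h => absurd (hzero.1 h).2 (not_le.2 hfb)
          rw [if_neg hZ, if_neg fun h => lt_asymm hfa' h.1, if_neg fun h => lt_asymm h1 h.2,
            if_neg fun h => lt_asymm hfb h.1, if_pos ⟨hfb, h2⟩]
        · have hZ : ∃ x ∈ Icc a b, f i x = 0 := hzero.2 ⟨hfa, hfb⟩
          rw [if_pos hZ, if_neg fun h => not_lt.2 hfa h.1, if_neg fun h => lt_asymm h1 h.2,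
            if_neg fun h => lt_asymm h2 h.2, if_neg fun h => not_lt.2 hfb h.1]
  have hsum := Finset.sum_congr rfl fun i (_ : i ∈ (Finset.univ : Finset (Fin r))) => key i
  simp only [Finset.sum_add_distrib, Finset.sum_boole, Nat.cast_id, Finset.sum_const,
    Finset.card_univ, Fintype.card_fin, smul_eq_mul, mul_one] at hsum
  convert hsum using 2

end Lemma5

/-! ### Lemma 4: following the `r` branches of a slice until one reaches the boundary -/

section Lemma4

variable {g : ℝ × E → E}

/-- Two order-topology lemmas: the largest `d ≤ B` with `[β, d) ⊆ P` for an open `P ∋ β`.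
[folklore] -/
theorem exists_right_end {P : Set ℝ} (hP : IsOpen P) {β B : ℝ} (hβ : β ∈ P) (hβB : β < B) :
    ∃ d, β < d ∧ d ≤ B ∧ Ico β d ⊆ P ∧ (d ∈ P → d = B) := by
  set S : Set ℝ := {a | a ≤ B ∧ Icc β a ⊆ P} with hS
  have hβS : β ∈ S :=
    ⟨hβB.le, fun t ht => by rw [show t = β from le_antisymm ht.2 ht.1]; exact hβ⟩
  have hbdd : BddAbove S := ⟨B, fun a ha => ha.1⟩
  have hne : S.Nonempty := ⟨β, hβS⟩
  set d := sSup S with hd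
  have hβd : β ≤ d := le_csSup hbdd hβS
  have hdB : d ≤ B := csSup_le hne fun a ha => ha.1
  have hIco : Ico β d ⊆ P := by
    intro t ht
    obtain ⟨a, haS, hta⟩ := exists_lt_of_lt_csSup hne ht.2
    exact haS.2 ⟨ht.1, hta.le⟩
  have hdP : d ∈ P → d = B := by
    intro hdP
    by_contra hne'
    have hlt : d < B := lt_of_le_of_ne hdB hne'
    obtain ⟨ε, hε, hball⟩ := Metric.isOpen_iff.1 hP d hdP
    have hdm : d < min (d + ε / 2) B := lt_min (by linarith) hlt
    have hmS : min (d + ε / 2) B ∈ S := by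
      refine ⟨min_le_right _ _, fun t ht => ?_⟩
      rcases lt_or_ge t d with htd | htd
      · exact hIco ⟨ht.1, htd⟩
      · apply hball
        rw [Real.ball_eq_Ioo]
        exact ⟨by linarith, by linarith [ht.2, min_le_left (d + ε / 2) B]⟩
    exact absurd (le_csSup hbdd hmS) (not_le.2 hdm)
  have hβd' : β < d := by
    rcases hβd.lt_or_eq with h | h
    · exact h
    · exact absurd (h.trans (hdP (h ▸ hβ))) hβB.ne
  exact ⟨d, hβd', hdB, hIco, hdP⟩

/-- The smallest `c ≥ B` with `(c, β] ⊆ P` for an open `P ∋ β`. [folklore] -/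
theorem exists_left_end {P : Set ℝ} (hP : IsOpen P) {β B : ℝ} (hβ : β ∈ P) (hBβ : B < β) :
    ∃ c, c < β ∧ B ≤ c ∧ Ioc c β ⊆ P ∧ (c ∈ P → c = B) := by
  set S : Set ℝ := {a | B ≤ a ∧ Icc a β ⊆ P} with hS
  have hβS : β ∈ S :=
    ⟨hBβ.le, fun t ht => by rw [show t = β from le_antisymm ht.2 ht.1]; exact hβ⟩
  have hbdd : BddBelow S := ⟨B, fun a ha => ha.1⟩
  have hne : S.Nonempty := ⟨β, hβS⟩
  set c := sInf S with hc
  have hcβ : c ≤ β := csInf_le hbdd hβS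
  have hBc : B ≤ c := le_csInf hne fun a ha => ha.1
  have hIoc : Ioc c β ⊆ P := by
    intro t ht
    obtain ⟨a, haS, hat⟩ := exists_lt_of_csInf_lt hne ht.1
    exact haS.2 ⟨hat.le, ht.2⟩
  have hcP : c ∈ P → c = B := by
    intro hcP
    by_contra hne'
    have hlt : B < c := lt_of_le_of_ne hBc (Ne.symm hne')
    obtain ⟨ε, hε, hball⟩ := Metric.isOpen_iff.1 hP c hcP
    have hmc : max (c - ε / 2) B < c := max_lt (by linarith) hlt
    have hmS : max (c - ε / 2) B ∈ S := by
      refine ⟨le_max_right _ _, fun t ht => ?_⟩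
      rcases lt_or_ge c t with hct | hct
      · exact hIoc ⟨hct, ht.2⟩
      · apply hball
        rw [Real.ball_eq_Ioo]
        exact ⟨by linarith [ht.1, le_max_left (c - ε / 2) B], by linarith⟩
    exact absurd (csInf_le hbdd hmS) (not_le.2 hmc)
  have hcβ' : c < β := by
    rcases hcβ.lt_or_eq with h | h
    · exact h
    · exact absurd ((hcP (h ▸ hβ)).symm.trans h) hBβ.ne
  exact ⟨c, hcβ', hBc, hIoc, hcP⟩

variable {r : ℕ}

/-- The predicate "(∗) holds at time `t`" of the proof of Lemma 4 (Wilkie 1989, p. 400): the `r`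
tracked branches (the maximal branches through the `r` points `(β, yᵢ)`) are defined at `t` and
lie in the open box `U_B`, and every other point of `V` over `t` lies outside `Ū_{B+1}`.
[cite: Wilkie1989, proof of Lemma 4, p. 400] -/
def Tracked (g : ℝ × E → E) (β : ℝ) (y : Fin r → E) (B t : ℝ) : Prop :=
  (∀ i, t ∈ maxDom g (β, y i) ∧ ‖maxBranch g (β, y i) t‖ < B) ∧
    ∀ z, g (t, z) = 0 → ‖z‖ ≤ B + 1 → ∃ i, t ∈ maxDom g (β, y i) ∧ z = maxBranch g (β, y i) t

section Tracked

variable (hg : IsRegular g) {β : ℝ} {y : Fin r → E} {B : ℝ}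

include hg

/-- Distinct tracked branches never meet. [cite: Wilkie1989, proof of Lemma 4, p. 400] -/
theorem eq_of_maxBranch_eq (hyV : ∀ i, g (β, y i) = 0) (hy : Injective y) {i j : Fin r} {t : ℝ}
    (hti : t ∈ maxDom g (β, y i)) (htj : t ∈ maxDom g (β, y j))
    (he : maxBranch g (β, y i) t = maxBranch g (β, y j) t) : i = j := by
  have h := maxBranch_apply_eq_of_eq hg (hyV i) hti htj he (mem_maxDom hg (hyV j))
  rw [maxBranch_apply_fst hg (hyV j)] at h
  exact hy h.symm

/-- At a tracked time the slice `V ∩ ({t} × Ū_B)` consists of the `r` tracked points. [cite: Wilkie1989, proof of Lemma 4, p. 400] -/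
theorem encard_slice_eq (hyV : ∀ i, g (β, y i) = 0) (hy : Injective y) {t : ℝ}
    (hdom : ∀ i, t ∈ maxDom g (β, y i) ∧ ‖maxBranch g (β, y i) t‖ ≤ B)
    (htr : ∀ z, g (t, z) = 0 → ‖z‖ ≤ B → ∃ i, z = maxBranch g (β, y i) t) :
    {z | g (t, z) = 0 ∧ ‖z‖ ≤ B}.encard = r := by
  have hset : {z | g (t, z) = 0 ∧ ‖z‖ ≤ B} = range fun i => maxBranch g (β, y i) t := by
    ext z
    constructor
    · rintro ⟨hz, hzB⟩
      obtain ⟨i, rfl⟩ := htr z hz hzB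
      exact ⟨i, rfl⟩
    · rintro ⟨i, rfl⟩
      exact ⟨maxBranch_eq_zero hg (hdom i).1, (hdom i).2⟩
  have hinj : Injective fun i => maxBranch g (β, y i) t :=
    fun i j hij => eq_of_maxBranch_eq hg hyV hy (hdom i).1 (hdom j).1 hij
  rw [hset, ← image_univ, hinj.encard_image, encard_univ]
  simp

/-- `(∗)` is an open condition (Wilkie: "By the continuity of the `θᵢ` … we can find `ε > 0` such
that for `t ∈ (β₁ - ε, β₁ + ε)` we have (∗)"; here for the untracked points an accumulation
argument replaces the finiteness of the set of branches). [cite: Wilkie1989, proof of Lemma 4, p. 400] -/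
theorem isOpen_tracked : IsOpen {t | Tracked g β y B t} := by
  rw [isOpen_iff_eventually]
  intro t ht
  have h1 : ∀ᶠ s in 𝓝 t, ∀ i, s ∈ maxDom g (β, y i) ∧ ‖maxBranch g (β, y i) s‖ < B := by
    refine eventually_all.2 fun i => ?_
    have hD : ∀ᶠ s in 𝓝 t, s ∈ maxDom g (β, y i) := isOpen_maxDom.mem_nhds (ht.1 i).1
    have hN : ∀ᶠ s in 𝓝 t, ‖maxBranch g (β, y i) s‖ < B :=
      (continuousAt_maxBranch hg (ht.1 i).1).norm.eventually_lt_const (ht.1 i).2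
    exact hD.and hN
  have h2 : ∀ᶠ s in 𝓝 t, ∀ z, g (s, z) = 0 → ‖z‖ ≤ B + 1 →
      ∃ i, s ∈ maxDom g (β, y i) ∧ z = maxBranch g (β, y i) s := by
    by_contra hcon
    have hfr : ∃ᶠ s in 𝓝 t, ∃ z, g (s, z) = 0 ∧ ‖z‖ ≤ B + 1 ∧
        ¬ ∃ i, s ∈ maxDom g (β, y i) ∧ z = maxBranch g (β, y i) s := by
      rw [not_eventually] at hcon
      refine hcon.mono fun s hs => ?_
      push Not at hs
      obtain ⟨z, hz, hzB, hzi⟩ := hs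
      exact ⟨z, hz, hzB, fun ⟨i, hi, hzi'⟩ => hzi i hi hzi'⟩
    have hacc : ∀ δ > (0 : ℝ), ∃ v ∈ {v : ℝ × E | g v = 0}, dist v.1 t < δ ∧
        v.2 ∈ closedBall (0 : E) (B + 1) ∧
        ¬ ∃ i, v.1 ∈ maxDom g (β, y i) ∧ v.2 = maxBranch g (β, y i) v.1 := by
      intro δ hδ
      obtain ⟨s, ⟨z, hz, hzB, hzi⟩, hs⟩ := (hfr.and_eventually (ball_mem_nhds t hδ)).exists
      exact ⟨(s, z), hz, hs, mem_closedBall_zero_iff.2 hzB, hzi⟩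
    obtain ⟨w, hwB, hwV, hW⟩ := exists_mem_of_forall_exists hg.isClosed
      (isCompact_closedBall 0 (B + 1)) hacc
    obtain ⟨i, hti, hwi⟩ := ht.2 w hwV (mem_closedBall_zero_iff.1 hwB)
    have hev := eventually_graph hg hti
    rw [← hwi] at hev
    obtain ⟨v, hv, hvV, hvQ⟩ := hW _ hev
    exact hvQ ⟨i, (hv hvV).1, (hv hvV).2⟩
  exact h1.and h2

/-- **The end point analysis** ("note that `lim_{t→d'⁻} φᵢ(t)` certainly exists … `d' ∈ Iᵢ` and
`θᵢ(d') ≤ B` for `i = 1, …, r`, and, for `j = r + 1, …, m`, if `d' ∈ Iⱼ` then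
`θⱼ(d') ≥ B + 1`", Wilkie 1989, p. 400): at a time `e` in the closure of a set of tracked times,
the tracked branches are defined with norm `≤ B`, and every point of `V` over `e` of norm
`< B + 1` is tracked. [cite: Wilkie1989, proof of Lemma 4, p. 400] -/
theorem closure_tracked (hyV : ∀ i, g (β, y i) = 0) {J : Set ℝ}
    (hJ : ∀ t ∈ J, Tracked g β y B t) {e : ℝ} (he : e ∈ closure J) :
    (∀ i, e ∈ maxDom g (β, y i) ∧ ‖maxBranch g (β, y i) e‖ ≤ B) ∧
      ∀ z, g (e, z) = 0 → ‖z‖ < B + 1 → ∃ i, z = maxBranch g (β, y i) e := by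
  have hfr : ∃ᶠ t in 𝓝 e, t ∈ J := mem_closure_iff_frequently.1 he
  have hdom : ∀ i, e ∈ maxDom g (β, y i) ∧ ‖maxBranch g (β, y i) e‖ ≤ B := by
    intro i
    have hfr' : ∃ᶠ t in 𝓝 e, t ∈ maxDom g (β, y i) ∧
        maxBranch g (β, y i) t ∈ closedBall (0 : E) B :=
      hfr.mono fun t ht => ⟨((hJ t ht).1 i).1, mem_closedBall_zero_iff.2 ((hJ t ht).1 i).2.le⟩
    have he' : e ∈ maxDom g (β, y i) :=
      mem_maxDom_of_frequently hg (hyV i) (isCompact_closedBall 0 B) hfr'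
    refine ⟨he', ?_⟩
    have hmem := (isClosed_closedBall (x := (0 : E)) (ε := B)).mem_of_frequently_of_tendsto
      (hfr'.mono fun t ht => ht.2) (continuousAt_maxBranch hg he')
    exact mem_closedBall_zero_iff.1 hmem
  refine ⟨hdom, fun z hz hzB => ?_⟩
  obtain ⟨bb, -, -⟩ := exists_branch hg hz
  have hc : ContinuousAt bb.toFun e :=
    (bb.continuousOn e bb.mem_dom).continuousAt (bb.isOpen_dom.mem_nhds bb.mem_dom)
  have hbe : bb.toFun e = z := bb.apply_fst
  have hlt : ∀ᶠ s in 𝓝 e, ‖bb.toFun s‖ < B + 1 := by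
    refine hc.norm.eventually_lt_const ?_
    show ‖bb.toFun e‖ < B + 1
    rw [hbe]
    exact hzB
  obtain ⟨s, hsJ, hsD, hsB⟩ :=
    (hfr.and_eventually ((bb.isOpen_dom.eventually_mem bb.mem_dom).and hlt)).exists
  obtain ⟨i, hsi, hsbi⟩ := (hJ s hsJ).2 (bb.toFun s) (bb.eq_zero s hsD) hsB.le
  -- uniqueness on the interval between `s` and `e`
  have hI1 : uIcc s e ⊆ maxDom g (β, y i) := ordConnected_maxDom.uIcc_subset hsi (hdom i).1
  have hI2 : uIcc s e ⊆ bb.dom := bb.isPreconnected_dom.ordConnected.uIcc_subset hsD bb.mem_dom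
  have heq := eqOn_of_isPreconnected hg isPreconnected_uIcc
    ((continuousOn_maxBranch hg).mono hI1) (bb.continuousOn.mono hI2)
    (fun t ht => maxBranch_eq_zero hg (hI1 ht)) (fun t ht => bb.eq_zero t (hI2 ht))
    left_mem_uIcc hsbi.symm
  exact ⟨i, by rw [← hbe]; exact (heq right_mem_uIcc).symm⟩

/-- At an untracked time in the closure of the tracked times, with `|e| ≤ B`: the slice over `e`
in the closed box has exactly `r` points and some point of `V` over `e` has (sup) norm `B` or
`B + 1` ("we must have either `θᵢ(d') = B` for some `i = 1, …, r`, or else `θⱼ(d') = B + 1` for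
some `j`", Wilkie 1989, p. 400). [cite: Wilkie1989, proof of Lemma 4, p. 400] -/
theorem endpoint (hyV : ∀ i, g (β, y i) = 0) (hy : Injective y) {J : Set ℝ}
    (hJ : ∀ t ∈ J, Tracked g β y B t) {e : ℝ} (he : e ∈ closure J) (hne : ¬ Tracked g β y B e)
    (heB : |e| ≤ B) :
    {z | g (e, z) = 0 ∧ ‖z‖ ≤ B}.encard = r ∧
      ∃ z, g (e, z) = 0 ∧ (‖(e, z)‖ = B ∨ ‖(e, z)‖ = B + 1) := by
  obtain ⟨hdom, htr⟩ := closure_tracked hg hyV hJ he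
  refine ⟨encard_slice_eq hg hyV hy hdom fun z hz hzB => htr z hz (by linarith), ?_⟩
  by_cases h1 : ∀ i, e ∈ maxDom g (β, y i) ∧ ‖maxBranch g (β, y i) e‖ < B
  · have h2 : ¬ ∀ z, g (e, z) = 0 → ‖z‖ ≤ B + 1 →
        ∃ i, e ∈ maxDom g (β, y i) ∧ z = maxBranch g (β, y i) e := fun h2 => hne ⟨h1, h2⟩
    push Not at h2
    obtain ⟨z, hz, hzB, hzi⟩ := h2
    have hge : B + 1 ≤ ‖z‖ := by
      by_contra hlt
      obtain ⟨i, rfl⟩ := htr z hz (not_le.1 hlt)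
      exact hzi i (hdom i).1 rfl
    refine ⟨z, hz, Or.inr ?_⟩
    rw [Prod.norm_mk, Real.norm_eq_abs, le_antisymm hzB hge]
    exact max_eq_right (by linarith)
  · push Not at h1
    obtain ⟨i, hi⟩ := h1
    have hge : B ≤ ‖maxBranch g (β, y i) e‖ := hi (hdom i).1
    refine ⟨maxBranch g (β, y i) e, maxBranch_eq_zero hg (hdom i).1, Or.inl ?_⟩
    rw [Prod.norm_mk, Real.norm_eq_abs, le_antisymm (hdom i).2 hge]
    exact max_eq_right heB

/-- The initial time is tracked. [cite: Wilkie1989, proof of Lemma 4, p. 400] -/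
theorem tracked_self (hyV : ∀ i, g (β, y i) = 0) (hyB : ∀ i, ‖y i‖ < B)
    (hgap : ∀ z, g (β, z) = 0 → ‖z‖ ≤ B + 1 → ∃ i, z = y i) : Tracked g β y B β := by
  refine ⟨fun i => ⟨mem_maxDom hg (hyV i), ?_⟩, fun z hz hzB => ?_⟩
  · rw [maxBranch_apply_fst hg (hyV i)]
    exact hyB i
  · obtain ⟨i, rfl⟩ := hgap z hz hzB
    exact ⟨i, mem_maxDom hg (hyV i), (maxBranch_apply_fst hg (hyV i)).symm⟩

omit [NormedSpace ℝ E] [FiniteDimensional ℝ E] hg in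
/-- In the gap `B ≤ ‖·‖ ≤ B + 1` there are no points of `V` over a tracked time `t` with
`|t| < B`. [cite: Wilkie1989, proof of Lemma 4, p. 400] -/
theorem gap_of_tracked {t : ℝ} (ht : Tracked g β y B t) (htB : |t| < B) (z : E)
    (hz : g (t, z) = 0) : ‖(t, z)‖ < B ∨ B + 1 < ‖(t, z)‖ := by
  rw [Prod.norm_mk, Real.norm_eq_abs]
  rcases lt_or_ge (B + 1) ‖z‖ with h | h
  · exact Or.inr (lt_max_of_lt_right h)
  · obtain ⟨i, hti, rfl⟩ := ht.2 z hz h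
    exact Or.inl (max_lt htB (ht.1 i).2)

/-- **Lemma 4, to the right of `β`** (the construction of `d`, Wilkie 1989, p. 400).
[cite: Wilkie1989, proof of Lemma 4, p. 400] -/
theorem lemma4_right (hyV : ∀ i, g (β, y i) = 0) (hy : Injective y) (hβB : β < B)
    (hBβ : -B < β) (hr : 0 < r) (hyB : ∀ i, ‖y i‖ < B)
    (hgap : ∀ z, g (β, z) = 0 → ‖z‖ ≤ B + 1 → ∃ i, z = y i) :
    ∃ d, β < d ∧ d ≤ B ∧ (∀ a ∈ Icc β d, {z | g (a, z) = 0 ∧ ‖z‖ ≤ B}.encard = r) ∧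
      (∃ z, g (d, z) = 0 ∧ (‖(d, z)‖ = B ∨ ‖(d, z)‖ = B + 1)) ∧
      (∀ a ∈ Ico β d, ∀ z, g (a, z) = 0 → ‖(a, z)‖ < B ∨ B + 1 < ‖(a, z)‖) := by
  have hPβ : Tracked g β y B β := tracked_self hg hyV hyB hgap
  obtain ⟨d, hβd, hdB, hIco, hdP⟩ :=
    exists_right_end (isOpen_tracked hg) (P := {t | Tracked g β y B t}) hPβ hβB
  have hcountP : ∀ a, Tracked g β y B a → {z | g (a, z) = 0 ∧ ‖z‖ ≤ B}.encard = r :=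
    fun a ha => encard_slice_eq hg hyV hy (fun i => ⟨(ha.1 i).1, (ha.1 i).2.le⟩)
      fun z hz hzB => (ha.2 z hz (by linarith)).imp fun i hi => hi.2
  have hgapI : ∀ a ∈ Ico β d, ∀ z, g (a, z) = 0 → ‖(a, z)‖ < B ∨ B + 1 < ‖(a, z)‖ :=
    fun a ha z hz => gap_of_tracked (hIco ha)
      (abs_lt.2 ⟨by linarith [ha.1], by linarith [ha.2]⟩) z hz
  by_cases hd : Tracked g β y B d
  · -- `d = B`: all of `[β, B]` is tracked
    have hdB' : d = B := hdP hd
    refine ⟨d, hβd, hdB, fun a ha => ?_, ?_, hgapI⟩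
    · rcases ha.2.lt_or_eq with h | h
      · exact hcountP a (hIco ⟨ha.1, h⟩)
      · rw [h]; exact hcountP d hd
    · refine ⟨maxBranch g (β, y ⟨0, hr⟩) d, maxBranch_eq_zero hg (hd.1 ⟨0, hr⟩).1, Or.inl ?_⟩
      have hB : (0 : ℝ) < B := by linarith
      rw [Prod.norm_mk, Real.norm_eq_abs, show |d| = B by rw [hdB', abs_of_pos hB]]
      exact max_eq_left (hd.1 ⟨0, hr⟩).2.le
  · -- `d` untracked: end point analysis
    have hcl : d ∈ closure (Ico β d) := by
      rw [closure_Ico hβd.ne]; exact right_mem_Icc.2 hβd.le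
    obtain ⟨hcount, hend⟩ := endpoint hg hyV hy (J := Ico β d) (fun t ht => hIco ht) hcl hd
      (abs_le.2 ⟨by linarith, hdB⟩)
    refine ⟨d, hβd, hdB, fun a ha => ?_, hend, hgapI⟩
    rcases ha.2.lt_or_eq with h | h
    · exact hcountP a (hIco ⟨ha.1, h⟩)
    · rw [h]; exact hcount

/-- **Lemma 4, to the left of `β`** ("The construction of `c` is similar", Wilkie 1989, p. 400).
[cite: Wilkie1989, proof of Lemma 4, p. 400] -/
theorem lemma4_left (hyV : ∀ i, g (β, y i) = 0) (hy : Injective y) (hβB : β < B)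
    (hBβ : -B < β) (hr : 0 < r) (hyB : ∀ i, ‖y i‖ < B)
    (hgap : ∀ z, g (β, z) = 0 → ‖z‖ ≤ B + 1 → ∃ i, z = y i) :
    ∃ c, c < β ∧ -B ≤ c ∧ (∀ a ∈ Icc c β, {z | g (a, z) = 0 ∧ ‖z‖ ≤ B}.encard = r) ∧
      (∃ z, g (c, z) = 0 ∧ (‖(c, z)‖ = B ∨ ‖(c, z)‖ = B + 1)) ∧
      (∀ a ∈ Ioc c β, ∀ z, g (a, z) = 0 → ‖(a, z)‖ < B ∨ B + 1 < ‖(a, z)‖) := by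
  have hPβ : Tracked g β y B β := tracked_self hg hyV hyB hgap
  obtain ⟨c, hcβ, hBc, hIoc, hcP⟩ :=
    exists_left_end (isOpen_tracked hg) (P := {t | Tracked g β y B t}) hPβ hBβ
  have hcountP : ∀ a, Tracked g β y B a → {z | g (a, z) = 0 ∧ ‖z‖ ≤ B}.encard = r :=
    fun a ha => encard_slice_eq hg hyV hy (fun i => ⟨(ha.1 i).1, (ha.1 i).2.le⟩)
      fun z hz hzB => (ha.2 z hz (by linarith)).imp fun i hi => hi.2
  have hgapI : ∀ a ∈ Ioc c β, ∀ z, g (a, z) = 0 → ‖(a, z)‖ < B ∨ B + 1 < ‖(a, z)‖ :=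
    fun a ha z hz => gap_of_tracked (hIoc ha)
      (abs_lt.2 ⟨by linarith [ha.1], by linarith [ha.2]⟩) z hz
  by_cases hc : Tracked g β y B c
  · have hcB' : c = -B := hcP hc
    refine ⟨c, hcβ, hBc, fun a ha => ?_, ?_, hgapI⟩
    · rcases ha.1.lt_or_eq with h | h
      · exact hcountP a (hIoc ⟨h, ha.2⟩)
      · rw [← h]; exact hcountP c hc
    · refine ⟨maxBranch g (β, y ⟨0, hr⟩) c, maxBranch_eq_zero hg (hc.1 ⟨0, hr⟩).1, Or.inl ?_⟩
      have hB : (0 : ℝ) < B := by linarith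
      rw [Prod.norm_mk, Real.norm_eq_abs, show |c| = B by rw [hcB', abs_neg, abs_of_pos hB]]
      exact max_eq_left (hc.1 ⟨0, hr⟩).2.le
  · have hcl : c ∈ closure (Ioc c β) := by
      rw [closure_Ioc hcβ.ne]; exact left_mem_Icc.2 hcβ.le
    obtain ⟨hcount, hend⟩ := endpoint hg hyV hy (J := Ioc c β) (fun t ht => hIoc ht) hcl hc
      (abs_le.2 ⟨by linarith, by linarith⟩)
    refine ⟨c, hcβ, hBc, fun a ha => ?_, hend, hgapI⟩
    rcases ha.1.lt_or_eq with h | h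
    · exact hcountP a (hIoc ⟨h, ha.2⟩)
    · rw [← h]; exact hcount

end Tracked

/-- **Wilkie 1989, Lemma 4, with the hypothesis only on the closed box `Ū_{B+1}`**: as
`lemma4` below (the printed statement assumes `V ∩ ({β₁} × U_B) = V ∩ ({β₁} × U_{B+2})`), but
assuming only that the points of `V` over `β₁` in `Ū_{B+1}` lie in `U_B` — which is all the printed
proof uses ("`θⱼ(t) ≥ B + 3/2` for `t` close to `β₁`", p. 400), and is the reading fixed in
`Wilkie1989Curves.lean`. [cite: Wilkie1989, Lemma 4 (proof, p. 400)] -/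
theorem lemma4_closure (hg : IsRegular g) {B β : ℝ} (hβ : |β| < B) {r : ℕ} (hr : 1 ≤ r)
    (hgap : ∀ z, g (β, z) = 0 → ‖z‖ ≤ B + 1 → ‖z‖ < B)
    (hcount : {z | g (β, z) = 0 ∧ ‖z‖ < B}.encard = r) :
    ∃ c d, -B ≤ c ∧ c < β ∧ β < d ∧ d ≤ B ∧
      (∀ a ∈ Icc c d, {z | g (a, z) = 0 ∧ ‖z‖ ≤ B}.encard = r) ∧
      (∀ a, a = c ∨ a = d → ∃ z, g (a, z) = 0 ∧ (‖(a, z)‖ = B ∨ ‖(a, z)‖ = B + 1)) ∧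
      (∀ a ∈ Ioo c d, ∀ z, g (a, z) = 0 → ‖(a, z)‖ < B ∨ B + 1 < ‖(a, z)‖) := by
  -- enumerate the `r` points of the slice over `β`
  obtain ⟨y, hy⟩ := exists_embedding_of_encard_eq hcount
  have hmem : ∀ i, y i ∈ {z | g (β, z) = 0 ∧ ‖z‖ < B} := fun i => hy ▸ mem_range_self i
  have hyV : ∀ i, g (β, y i) = 0 := fun i => (hmem i).1
  have hyB : ∀ i, ‖y i‖ < B := fun i => (hmem i).2
  have hgap' : ∀ z, g (β, z) = 0 → ‖z‖ ≤ B + 1 → ∃ i, z = y i := by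
    intro z hz hzB
    have hmem : z ∈ range y := by rw [hy]; exact ⟨hz, hgap z hz hzB⟩
    obtain ⟨i, rfl⟩ := hmem
    exact ⟨i, rfl⟩
  have hβB : β < B := (abs_lt.1 hβ).2
  have hBβ : -B < β := (abs_lt.1 hβ).1
  obtain ⟨d, hβd, hdB, hcd, hed, hgd⟩ := lemma4_right hg hyV y.injective hβB hBβ hr hyB hgap'
  obtain ⟨c, hcβ, hBc, hcc, hec, hgc⟩ := lemma4_left hg hyV y.injective hβB hBβ hr hyB hgap'
  refine ⟨c, d, hBc, hcβ, hβd, hdB, fun a ha => ?_, ?_, fun a ha z hz => ?_⟩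
  · rcases le_total a β with h | h
    · exact hcc a ⟨ha.1, h⟩
    · exact hcd a ⟨h, ha.2⟩
  · rintro a (rfl | rfl)
    · exact hec
    · exact hed
  · rcases lt_or_ge a β with h | h
    · exact hgc a ⟨ha.1, h.le⟩ z hz
    · exact hgd a ⟨h, ha.2⟩ z hz

/-- **Wilkie 1989, Lemma 4** (pp. 399–400).  "Suppose `B ∈ ℝ`, `B > 0`, `n ∈ ℕ`, `n ≥ 2`, and let
`g₁, …, gₙ₋₁ : ℝⁿ → ℝ` be continuously differentiable. Let
`V = {ᾱ ∈ ℝⁿ : gᵢ(ᾱ) = 0 for i = 1, …, n - 1}` and suppose that for each `ᾱ ∈ V`,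
`det (∂(g₁, …, gₙ₋₁)/∂(x₂, …, xₙ))(ᾱ) ≠ 0`. [Suppose further that `V` is the union of finitely
many connected components — not needed here, see the module docstring.] For `a ∈ ℝ`, define
`U_a = {(α₂, …, αₙ) ∈ ℝⁿ⁻¹ : |αᵢ| < a for i = 2, …, n}`, and let `Ū_a` be the closure of
`U_a`. Let `β₁ ∈ ℝ`, `|β₁| < B`, `r ∈ ℕ`, `r ≥ 1`, and assume that
`V ∩ ({β₁} × U_B) = V ∩ ({β₁} × U_{B+2})` and that these sets contain exactly `r` points. Then
there exist `c, d ∈ ℝ`, `-B ≤ c < β₁ < d ≤ B` such that for each `a ∈ [c, d]`,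
`V ∩ ({a} × Ū_B)` contains exactly `r` points and, further, if `α₁ ∈ {c, d}` then for some
`(α₁, α₂, …, αₙ) ∈ V` we have `max {|αᵢ| : 1 ≤ i ≤ n} ∈ {B, B + 1}`. Also, for `a ∈ (c, d)`
and any `(α₁, α₂, …, αₙ) ∈ V` [with `α₁ = a`], setting `max {|αᵢ| : 1 ≤ i ≤ n} = θ` we have
either `θ < B` or `θ > B + 1`."  Here `ℝⁿ = ℝ × E`, `U_a` is the open ball of radius `a` of
`E` and `max {|αᵢ|}` the sup norm of `ℝ × E` (see the module docstring for the reading of the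
boxes). [cite: Wilkie1989, Lemma 4] -/
theorem lemma4 (hg : IsRegular g) {B β : ℝ} (hβ : |β| < B) {r : ℕ} (hr : 1 ≤ r)
    (hgap : ∀ z, g (β, z) = 0 → ‖z‖ < B + 2 → ‖z‖ < B)
    (hcount : {z | g (β, z) = 0 ∧ ‖z‖ < B}.encard = r) :
    ∃ c d, -B ≤ c ∧ c < β ∧ β < d ∧ d ≤ B ∧
      (∀ a ∈ Icc c d, {z | g (a, z) = 0 ∧ ‖z‖ ≤ B}.encard = r) ∧
      (∀ a, a = c ∨ a = d → ∃ z, g (a, z) = 0 ∧ (‖(a, z)‖ = B ∨ ‖(a, z)‖ = B + 1)) ∧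
      (∀ a ∈ Ioo c d, ∀ z, g (a, z) = 0 → ‖(a, z)‖ < B ∨ B + 1 < ‖(a, z)‖) :=
  lemma4_closure hg hβ hr (fun z hz hzB => hgap z hz (by linarith)) hcount

end Lemma4

/-! ### Lemma 6: counting the zeros of a function on `V ∩ ([c, d] × Ū_B)` -/

section Lemma6

variable {g : ℝ × E → E}

/-- **Wilkie's `g*`** (Lemma 6, p. 401) for a function `h` (Wilkie's `g`) on `ℝ × E`: the
derivative of `h` along the solution branches of `g = 0`, i.e. in the direction of the tangent
vector `(1, -(∂g/∂y)⁻¹ ∂g/∂x₁)`; expanded, this is Wilkie's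
`g* = ∂g/∂x₁ - (∂g/∂x₂, …, ∂g/∂xₙ) · (∂(g₁, …, gₙ₋₁)/∂(x₂, …, xₙ))⁻¹ · (∂g₁/∂x₁, …, ∂gₙ₋₁/∂x₁)ᵀ`
(`star_eq`). [cite: Wilkie1989, Lemma 6] -/
def star (g : ℝ × E → E) (h : ℝ × E → ℝ) (v : ℝ × E) : ℝ :=
  fderiv ℝ h v (1, tangentSlope g v)

omit [FiniteDimensional ℝ E] in
/-- Wilkie's formula for `g*`: `∂h/∂x₁ - ∂h/∂y ∘ (∂g/∂y)⁻¹ (∂g/∂x₁)`. [cite: Wilkie1989, Lemma 6] -/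
theorem star_eq (g : ℝ × E → E) (h : ℝ × E → ℝ) (v : ℝ × E) :
    star g h v = fderiv ℝ h v (1, 0) -
      (fderiv ℝ h v ∘L ContinuousLinearMap.inr ℝ ℝ E)
        ((fderiv ℝ g v ∘L ContinuousLinearMap.inr ℝ ℝ E).inverse (fderiv ℝ g v (1, 0))) := by
  have e : ((1 : ℝ), tangentSlope g v) = ((1 : ℝ), (0 : E)) -
      ((0 : ℝ), (fderiv ℝ g v ∘L ContinuousLinearMap.inr ℝ ℝ E).inverse (fderiv ℝ g v (1, 0))) := by
    simp [tangentSlope]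
  rw [star, e, map_sub]
  rfl

/-- **The derivative of `h` along a branch is `g*`** ("a calculation similar to those of Section 2
shows that `fᵢ'(t) = g*(t, φ⁽²⁾ᵢ(t), …, φ⁽ⁿ⁾ᵢ(t))`", Wilkie 1989, p. 402). [cite: Wilkie1989, proof of Lemma 6, p. 402] -/
theorem hasDerivAt_comp_maxBranch (hg : IsRegular g) {h : ℝ × E → ℝ} (hh : ContDiff ℝ 1 h)
    {u : ℝ × E} {t : ℝ} (ht : t ∈ maxDom g u) :
    HasDerivAt (fun s => h (s, maxBranch g u s)) (star g h (t, maxBranch g u t)) t := by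
  have hγ : HasDerivAt (fun s => (s, maxBranch g u s))
      ((1 : ℝ), tangentSlope g (t, maxBranch g u t)) t :=
    (hasDerivAt_id t).prodMk (hasDerivAt_maxBranch hg ht)
  have hh' : HasFDerivAt h (fderiv ℝ h (t, maxBranch g u t)) (t, maxBranch g u t) :=
    ((hh.differentiable one_ne_zero) _).hasFDerivAt
  exact hh'.comp_hasDerivAt t hγ

omit [FiniteDimensional ℝ E] in
/-- A function with non-vanishing derivative on `[a, b]` is injective there (Darboux and the mean
value theorem). [folklore] -/
theorem injOn_Icc_of_deriv_ne_zero {a b : ℝ} {f f' : ℝ → ℝ}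
    (hf : ∀ x ∈ Icc a b, HasDerivWithinAt f (f' x) (Icc a b) x) (hf' : ∀ x ∈ Icc a b, f' x ≠ 0) :
    InjOn f (Icc a b) := by
  have hcont : ContinuousOn f (Icc a b) := fun x hx => (hf x hx).continuousWithinAt
  have hderiv : ∀ x ∈ interior (Icc a b), deriv f x = f' x := by
    intro x hx
    rw [interior_Icc] at hx
    exact ((hf x (Ioo_subset_Icc_self hx)).hasDerivAt (Icc_mem_nhds hx.1 hx.2)).deriv
  rcases hasDerivWithinAt_forall_lt_or_forall_gt_of_forall_ne (convex_Icc a b) hf hf'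
    with hneg | hpos
  · refine (strictAntiOn_of_deriv_neg (convex_Icc a b) hcont fun x hx => ?_).injOn
    rw [hderiv x hx]
    rw [interior_Icc] at hx
    exact hneg x (Ioo_subset_Icc_self hx)
  · refine (strictMonoOn_of_deriv_pos (convex_Icc a b) hcont fun x hx => ?_).injOn
    rw [hderiv x hx]
    rw [interior_Icc] at hx
    exact hpos x (Ioo_subset_Icc_self hx)

/-- **Wilkie 1989, Lemma 6** (pp. 401–402).  "Suppose `n ≥ 2`, `g₁, …, gₙ₋₁ : ℝⁿ → ℝ` are
continuously differentiable, and let `V = {ᾱ ∈ ℝⁿ : gᵢ(ᾱ) = 0 for i = 1, …, n - 1}`. Suppose that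
for each `ᾱ ∈ V`, `det (∂(g₁, …, gₙ₋₁)/∂(x₂, …, xₙ))(ᾱ) ≠ 0`. Let `B, c, d ∈ ℝ`, `B > 0`,
`-B < c < d < B`, and suppose that for each `a ∈ [c, d]`, `V ∩ ({a} × Ū_B)` contains exactly `r`
points where `r ∈ ℕ`, `r ≥ 1` …. Suppose further that for `a ∈ (c, d)`,
`V ∩ ({a} × U_B) = V ∩ ({a} × Ū_B)`. Let `g : ℝⁿ → ℝ` be continuously differentiable and define
`g* : V → ℝ` by `g* = ∂g/∂x₁ - (∂g/∂x₂, …, ∂g/∂xₙ) · (∂(g₁, …, gₙ₋₁)/∂(x₂, …, xₙ))⁻¹ ·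
(∂g₁/∂x₁, …, ∂gₙ₋₁/∂x₁)ᵀ` and suppose that for all `x̄ ∈ V`, `g*(x̄) ≠ 0`. Then the number of
zeroes of `g` on `V ∩ ([c, d] × Ū_B)` is given by
`r - |S(c)(+,+)| - |S(c)(-,-)| - |S(d)(+,-)| - |S(d)(-,+)|` where for example,
`S(d)(+,-) = {x̄ ∈ V ∩ ({d} × Ū_B) : g(x̄) > 0 and g*(x̄) < 0}`."  Here `h` is Wilkie's `g`,
`star g h` is `g*`, the identity is written additively (in `ℕ∞`, all sets being finite), and the
inessential hypotheses `B > 0`, `-B < c`, `d < B`, `r ≥ 1` are dropped, `g* ≠ 0` being required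
only on `V ∩ ([c, d] × Ū_B)`. [cite: Wilkie1989, Lemma 6] -/
theorem lemma6 (hg : IsRegular g) {h : ℝ × E → ℝ} (hh : ContDiff ℝ 1 h) {B c d : ℝ}
    (hcd : c < d) {r : ℕ}
    (hcount : ∀ a ∈ Icc c d, {z | g (a, z) = 0 ∧ ‖z‖ ≤ B}.encard = r)
    (hbox : ∀ a ∈ Ioo c d, ∀ z, g (a, z) = 0 → ‖z‖ ≤ B → ‖z‖ < B)
    (hstar : ∀ v, g v = 0 → v.1 ∈ Icc c d → ‖v.2‖ ≤ B → star g h v ≠ 0) :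
    {v : ℝ × E | g v = 0 ∧ v.1 ∈ Icc c d ∧ ‖v.2‖ ≤ B ∧ h v = 0}.encard
      + {z | g (c, z) = 0 ∧ ‖z‖ ≤ B ∧ 0 < h (c, z) ∧ 0 < star g h (c, z)}.encard
      + {z | g (c, z) = 0 ∧ ‖z‖ ≤ B ∧ h (c, z) < 0 ∧ star g h (c, z) < 0}.encard
      + {z | g (d, z) = 0 ∧ ‖z‖ ≤ B ∧ 0 < h (d, z) ∧ star g h (d, z) < 0}.encard
      + {z | g (d, z) = 0 ∧ ‖z‖ ≤ B ∧ h (d, z) < 0 ∧ 0 < star g h (d, z)}.encard = r := by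
  classical
  -- Step 1: the `r` points over the middle time `t₀`
  set t₀ := (c + d) / 2 with ht₀
  have ht₀I : t₀ ∈ Ioo c d := ⟨by rw [ht₀]; linarith, by rw [ht₀]; linarith⟩
  obtain ⟨w, hw⟩ := exists_embedding_of_encard_eq (hcount t₀ (Ioo_subset_Icc_self ht₀I))
  have hwmem : ∀ j, w j ∈ {z | g (t₀, z) = 0 ∧ ‖z‖ ≤ B} := fun j => hw ▸ mem_range_self j
  have hwV : ∀ j, g (t₀, w j) = 0 := fun j => (hwmem j).1
  -- the branches `Ψⱼ` through the points `(t₀, wⱼ)`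
  set Ψ : Fin r → ℝ → E := fun j => maxBranch g (t₀, w j) with hΨ
  -- Step 2: on `(c, d)` every branch is defined and lies in the open box
  have hA : ∀ j, ∀ t ∈ Ioo c d, t ∈ maxDom g (t₀, w j) ∧ ‖Ψ j t‖ < B := by
    intro j
    let A : Set ℝ := {t ∈ Ioo c d | t ∈ maxDom g (t₀, w j) ∧ ‖Ψ j t‖ < B}
    have hsub : Ioo c d ⊆ A := by
      refine subset_of_relClopen isPreconnected_Ioo (fun t ht => ht.1)
        ⟨t₀, ht₀I, mem_maxDom hg (hwV j), ?_⟩ (fun t ht => ?_) (fun t htI htc => ?_)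
      · show ‖maxBranch g (t₀, w j) t₀‖ < B
        rw [maxBranch_apply_fst hg (hwV j)]
        exact hbox t₀ ht₀I (w j) (hwV j) (hwmem j).2
      · have h1 : ∀ᶠ s in 𝓝 t, s ∈ maxDom g (t₀, w j) := isOpen_maxDom.mem_nhds ht.2.1
        have h2 : ∀ᶠ s in 𝓝 t, ‖Ψ j s‖ < B :=
          (continuousAt_maxBranch hg ht.2.1).norm.eventually_lt_const ht.2.2
        obtain ⟨N, hN, hNs⟩ := (h1.and h2).exists_mem
        exact ⟨N, hN, fun s hs => ⟨hs.2, hNs s hs.1⟩⟩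
      · have hfr : ∃ᶠ s in 𝓝 t, s ∈ A := mem_closure_iff_frequently.1 htc
        have hfr' : ∃ᶠ s in 𝓝 t, s ∈ maxDom g (t₀, w j) ∧ Ψ j s ∈ closedBall (0 : E) B :=
          hfr.mono fun s hs => ⟨hs.2.1, mem_closedBall_zero_iff.2 hs.2.2.le⟩
        have htD : t ∈ maxDom g (t₀, w j) :=
          mem_maxDom_of_frequently hg (hwV j) (isCompact_closedBall 0 B) hfr'
        have hle : ‖Ψ j t‖ ≤ B := mem_closedBall_zero_iff.1
          (isClosed_closedBall.mem_of_frequently_of_tendsto (hfr'.mono fun s hs => hs.2)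
            (continuousAt_maxBranch hg htD))
        exact ⟨htI, htD, hbox t htI _ (maxBranch_eq_zero hg htD) hle⟩
    exact fun t ht => (hsub ht).2
  -- Step 3: on `[c, d]` every branch is defined and lies in the closed box
  have hBcl : ∀ j, ∀ t ∈ Icc c d, t ∈ maxDom g (t₀, w j) ∧ ‖Ψ j t‖ ≤ B := by
    intro j t ht
    have htc : t ∈ closure (Ioo c d) := by rw [closure_Ioo hcd.ne]; exact ht
    have hfr : ∃ᶠ s in 𝓝 t, s ∈ Ioo c d := mem_closure_iff_frequently.1 htc
    have hfr' : ∃ᶠ s in 𝓝 t, s ∈ maxDom g (t₀, w j) ∧ Ψ j s ∈ closedBall (0 : E) B :=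
      hfr.mono fun s hs => ⟨(hA j s hs).1, mem_closedBall_zero_iff.2 (hA j s hs).2.le⟩
    have htD : t ∈ maxDom g (t₀, w j) :=
      mem_maxDom_of_frequently hg (hwV j) (isCompact_closedBall 0 B) hfr'
    exact ⟨htD, mem_closedBall_zero_iff.1 (isClosed_closedBall.mem_of_frequently_of_tendsto
      (hfr'.mono fun s hs => hs.2) (continuousAt_maxBranch hg htD))⟩
  -- Step 4: the slices over `[c, d]` consist of the (pairwise distinct) branch points
  have hinj : ∀ t ∈ Icc c d, Injective fun j => Ψ j t := fun t ht i j hij =>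
    eq_of_maxBranch_eq hg hwV w.injective (hBcl i t ht).1 (hBcl j t ht).1 hij
  have hslice : ∀ t ∈ Icc c d, ∀ z, g (t, z) = 0 → ‖z‖ ≤ B → ∃ j, z = Ψ j t := by
    intro t ht
    have hsub : range (fun j => Ψ j t) ⊆ {z | g (t, z) = 0 ∧ ‖z‖ ≤ B} := by
      rintro _ ⟨j, rfl⟩
      exact ⟨maxBranch_eq_zero hg (hBcl j t ht).1, (hBcl j t ht).2⟩
    have hr1 : (range fun j => Ψ j t).encard = r := by
      rw [← image_univ, (hinj t ht).encard_image, encard_univ]; simp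
    have heq : range (fun j => Ψ j t) = {z | g (t, z) = 0 ∧ ‖z‖ ≤ B} :=
      (finite_range _).eq_of_subset_of_encard_le hsub (by rw [hr1, hcount t ht])
    intro z hz hzB
    have hz' : z ∈ range fun j => Ψ j t := by rw [heq]; exact ⟨hz, hzB⟩
    obtain ⟨j, rfl⟩ := hz'
    exact ⟨j, rfl⟩
  -- Step 5: the functions `fⱼ(t) = h(t, Ψⱼ(t))`, and Lemma 5
  set f : Fin r → ℝ → ℝ := fun j t => h (t, Ψ j t) with hf
  set f' : Fin r → ℝ → ℝ := fun j t => star g h (t, Ψ j t) with hf'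
  have hderiv : ∀ j, ∀ t ∈ Icc c d, HasDerivWithinAt (f j) (f' j t) (Icc c d) t :=
    fun j t ht => (hasDerivAt_comp_maxBranch hg hh (hBcl j t ht).1).hasDerivWithinAt
  have hne : ∀ j, ∀ t ∈ Icc c d, f' j t ≠ 0 := fun j t ht =>
    hstar (t, Ψ j t) (maxBranch_eq_zero hg (hBcl j t ht).1) ht (hBcl j t ht).2
  have h5 := lemma5 hcd.le f f' hderiv hne
  -- Step 6: the four sign counts at the end points
  have hS : ∀ a ∈ Icc c d, ∀ P : ℝ → ℝ → Prop,
      {z | g (a, z) = 0 ∧ ‖z‖ ≤ B ∧ P (h (a, z)) (star g h (a, z))}.encard =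
        (Finset.univ.filter fun j => P (f j a) (f' j a)).card := by
    intro a ha P
    have hset : {z | g (a, z) = 0 ∧ ‖z‖ ≤ B ∧ P (h (a, z)) (star g h (a, z))} =
        (fun j => Ψ j a) '' {j | P (f j a) (f' j a)} := by
      ext z
      constructor
      · rintro ⟨hz, hzB, hP⟩
        obtain ⟨j, rfl⟩ := hslice a ha z hz hzB
        exact ⟨j, hP, rfl⟩
      · rintro ⟨j, hj, rfl⟩
        exact ⟨maxBranch_eq_zero hg (hBcl j a ha).1, (hBcl j a ha).2, hj⟩
    rw [hset, ((hinj a ha).injOn).encard_image]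
    rw [show {j | P (f j a) (f' j a)} = ↑(Finset.univ.filter fun j => P (f j a) (f' j a)) by
      ext j; simp]
    exact encard_coe_eq_coe_finsetCard _
  -- Step 7: the zeros
  have hinjf : ∀ j, InjOn (f j) (Icc c d) := fun j => injOn_Icc_of_deriv_ne_zero (hderiv j) (hne j)
  have hZ : {v : ℝ × E | g v = 0 ∧ v.1 ∈ Icc c d ∧ ‖v.2‖ ≤ B ∧ h v = 0}.encard =
      (Finset.univ.filter fun j => ∃ x ∈ Icc c d, f j x = 0).card := by
    let x : Fin r → ℝ := fun j => if hj : ∃ x ∈ Icc c d, f j x = 0 then hj.choose else c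
    have hx : ∀ j, (∃ x ∈ Icc c d, f j x = 0) → x j ∈ Icc c d ∧ f j (x j) = 0 := by
      intro j hj
      simp only [x, dif_pos hj]
      exact hj.choose_spec
    have hset : {v : ℝ × E | g v = 0 ∧ v.1 ∈ Icc c d ∧ ‖v.2‖ ≤ B ∧ h v = 0} =
        (fun j => (x j, Ψ j (x j))) '' {j | ∃ x ∈ Icc c d, f j x = 0} := by
      ext ⟨t, z⟩
      constructor
      · rintro ⟨hv, ht, hzB, hhv⟩
        obtain ⟨j, rfl⟩ := hslice t ht z hv hzB
        have hj : ∃ x ∈ Icc c d, f j x = 0 := ⟨t, ht, hhv⟩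
        have hxt : x j = t := hinjf j (hx j hj).1 ht ((hx j hj).2.trans hhv.symm)
        exact ⟨j, hj, by show (x j, Ψ j (x j)) = (t, Ψ j t); rw [hxt]⟩
      · rintro ⟨j, hj, hjv⟩
        rw [← hjv]
        exact ⟨maxBranch_eq_zero hg (hBcl j _ (hx j hj).1).1, (hx j hj).1,
          (hBcl j _ (hx j hj).1).2, (hx j hj).2⟩
    have hinj' : InjOn (fun j => (x j, Ψ j (x j))) {j | ∃ x ∈ Icc c d, f j x = 0} := by
      intro i hi j hj hij
      simp only [Prod.mk.injEq] at hij
      obtain ⟨h1, h2⟩ := hij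
      rw [h1] at h2
      exact hinj (x j) (hx j hj).1 h2
    rw [hset, hinj'.encard_image]
    rw [show {j | ∃ x ∈ Icc c d, f j x = 0} =
      ↑(Finset.univ.filter fun j => ∃ x ∈ Icc c d, f j x = 0) by ext j; simp]
    exact encard_coe_eq_coe_finsetCard _
  -- Step 8: assemble
  rw [hZ, hS c (left_mem_Icc.2 hcd.le) (fun p q => 0 < p ∧ 0 < q),
    hS c (left_mem_Icc.2 hcd.le) (fun p q => p < 0 ∧ q < 0),
    hS d (right_mem_Icc.2 hcd.le) (fun p q => 0 < p ∧ q < 0),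
    hS d (right_mem_Icc.2 hcd.le) (fun p q => p < 0 ∧ 0 < q)]
  exact_mod_cast h5

end Lemma6


end ImplicitCurve

/-! ### Lemmas 4 and 6 in the coordinates of `Wilkie1989Curves.lean` -/

namespace SpaceCurve

open ImplicitCurve
open scoped Matrix

variable {m : ℕ}

/-! #### Splitting off the first coordinate: `ℝⁿ = ℝ × ℝⁿ⁻¹` -/

/-- `(t, y) ↦ (t, y₁, …, yₘ)`: gluing the first coordinate back, as a continuous linear map.
[folklore] -/
def consCLM (m : ℕ) : ℝ × (Fin m → ℝ) →L[ℝ] (Fin (m + 1) → ℝ) :=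
  LinearMap.toContinuousLinearMap
    { toFun := fun p => Fin.cons p.1 p.2
      map_add' := fun p q => by
        ext k
        refine Fin.cases ?_ (fun j => ?_) k <;> simp
      map_smul' := fun c p => by
        ext k
        refine Fin.cases ?_ (fun j => ?_) k <;> simp }

/-- `consCLM` is `Fin.cons`. [folklore] -/
@[simp] theorem consCLM_apply (p : ℝ × (Fin m → ℝ)) :
    consCLM m p = Fin.cons p.1 p.2 := rfl

/-- `(0, eⱼ) ↦ e_{j+1}`. [folklore] -/
theorem cons_zero_single (j : Fin m) :
    (Fin.cons 0 (Pi.single j 1) : Fin (m + 1) → ℝ) = Pi.single j.succ 1 := by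
  ext k
  refine Fin.cases ?_ (fun l => ?_) k
  · simp [Fin.succ_ne_zero]
  · rw [Fin.cons_succ]
    by_cases h : l = j
    · subst h; simp
    · rw [Pi.single_eq_of_ne h, Pi.single_eq_of_ne (fun h' => h (Fin.succ_injective _ h'))]

/-- `(1, 0) ↦ e₁` (Wilkie's `x₁`-direction). [folklore] -/
theorem cons_one_zero : (Fin.cons 1 (0 : Fin m → ℝ) : Fin (m + 1) → ℝ) = Pi.single 0 1 := by
  ext k
  refine Fin.cases ?_ (fun l => ?_) k
  · simp
  · rw [Fin.cons_succ, Pi.single_eq_of_ne (Fin.succ_ne_zero l)]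
    rfl

/-- The sup norm splits: `‖(t, y₁, …, yₘ)‖ = max (|t|, ‖y‖)`, i.e. `consCLM` is an isometry for
the sup norms. [folklore] -/
theorem norm_cons (t : ℝ) (y : Fin m → ℝ) : ‖(Fin.cons t y : Fin (m + 1) → ℝ)‖ = ‖(t, y)‖ := by
  rw [Prod.norm_mk]
  apply le_antisymm
  · refine (pi_norm_le_iff_of_nonneg (le_max_of_le_left (norm_nonneg t))).2 fun k => ?_
    refine Fin.cases ?_ (fun j => ?_) k
    · rw [Fin.cons_zero]; exact le_max_left _ _
    · rw [Fin.cons_succ]; exact (norm_le_pi_norm y j).trans (le_max_right _ _)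
  · refine max_le ?_ ?_
    · have := norm_le_pi_norm (Fin.cons t y : Fin (m + 1) → ℝ) 0
      rwa [Fin.cons_zero] at this
    · refine (pi_norm_le_iff_of_nonneg (norm_nonneg _)).2 fun j => ?_
      have := norm_le_pi_norm (Fin.cons t y : Fin (m + 1) → ℝ) j.succ
      rwa [Fin.cons_succ] at this

/-- Wilkie's open box is the open sup-norm ball: `U_B = {‖y‖ < B}` (`B > 0`). [folklore] -/
theorem mem_box_iff_norm_lt {B : ℝ} (hB : 0 < B) (y : Fin m → ℝ) : y ∈ box B ↔ ‖y‖ < B := by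
  rw [mem_box, pi_norm_lt_iff hB]
  simp [Real.norm_eq_abs]

/-- The closure of Wilkie's box is the closed sup-norm ball: `Ū_B = {‖y‖ ≤ B}` (`B > 0`).
[folklore] -/
theorem mem_closure_box_iff_norm_le {B : ℝ} (hB : 0 < B) (y : Fin m → ℝ) :
    y ∈ closure (box B) ↔ ‖y‖ ≤ B := by
  have hbox : (box B : Set (Fin m → ℝ)) = Set.pi univ fun _ => Ioo (-B) B := by
    ext z; simp [box, abs_lt]
  rw [hbox, closure_pi_set, pi_norm_le_iff_of_nonneg hB.le]
  simp only [mem_univ_pi, closure_Ioo (by linarith : (-B : ℝ) ≠ B), mem_Icc, Real.norm_eq_abs,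
    abs_le]

/-! #### The system in product form -/

/-- The system `g = (g₁, …, gₘ)` as a map `ℝ × ℝᵐ → ℝᵐ`. [folklore] -/
def prodSys (g : Fin m → (Fin (m + 1) → ℝ) → ℝ) (v : ℝ × (Fin m → ℝ)) : Fin m → ℝ :=
  fun i => g i (Fin.cons v.1 v.2)

/-- A function on `ℝ^{m+1}` as a function on `ℝ × ℝᵐ`. [folklore] -/
def prodFun (h : (Fin (m + 1) → ℝ) → ℝ) (v : ℝ × (Fin m → ℝ)) : ℝ :=
  h (Fin.cons v.1 v.2)

variable {g : Fin m → (Fin (m + 1) → ℝ) → ℝ} {h : (Fin (m + 1) → ℝ) → ℝ}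

/-- Unfolding `prodSys`. [folklore] -/
@[simp] theorem prodSys_apply (v : ℝ × (Fin m → ℝ)) (i : Fin m) :
    prodSys g v i = g i (Fin.cons v.1 v.2) := rfl

/-- Unfolding `prodFun`. [folklore] -/
@[simp] theorem prodFun_apply (v : ℝ × (Fin m → ℝ)) : prodFun h v = h (Fin.cons v.1 v.2) := rfl

/-- `prodSys g (a, y) = 0` iff `(a, y) ∈ V`. [folklore] -/
theorem prodSys_eq_zero_iff (v : ℝ × (Fin m → ℝ)) :
    prodSys g v = 0 ↔ (Fin.cons v.1 v.2 : Fin (m + 1) → ℝ) ∈ zeroLocus g := by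
  simp [funext_iff, prodSys]

/-- `prodSys g` is `C¹` when the `gᵢ` are. [folklore] -/
theorem contDiff_prodSys (hg : ∀ i, ContDiff ℝ 1 (g i)) : ContDiff ℝ 1 (prodSys g) :=
  contDiff_pi.2 fun i => by
    have : (fun v : ℝ × (Fin m → ℝ) => prodSys g v i) = g i ∘ consCLM m := rfl
    rw [this]
    exact (hg i).comp (consCLM m).contDiff

/-- `prodFun h` is `C¹` when `h` is. [folklore] -/
theorem contDiff_prodFun (hh : ContDiff ℝ 1 h) : ContDiff ℝ 1 (prodFun h) := by
  have : (prodFun h : ℝ × (Fin m → ℝ) → ℝ) = h ∘ consCLM m := rfl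
  rw [this]
  exact hh.comp (consCLM m).contDiff

/-- The derivative of `prodSys g` (chain rule). [folklore] -/
theorem fderiv_prodSys_apply (hg : ∀ i, ContDiff ℝ 1 (g i)) (v w : ℝ × (Fin m → ℝ)) (i : Fin m) :
    fderiv ℝ (prodSys g) v w i = fderiv ℝ (g i) (Fin.cons v.1 v.2) (Fin.cons w.1 w.2) := by
  have hd : HasFDerivAt (prodSys g) (ContinuousLinearMap.pi fun i =>
      (fderiv ℝ (g i) (Fin.cons v.1 v.2)).comp (consCLM m)) v := by
    refine hasFDerivAt_pi.2 fun i => ?_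
    have hgi : HasFDerivAt (g i) (fderiv ℝ (g i) (consCLM m v)) (consCLM m v) :=
      ((hg i).differentiable one_ne_zero _).hasFDerivAt
    exact hgi.comp v (consCLM m).hasFDerivAt
  rw [hd.fderiv]
  rfl

/-- The derivative of `prodFun h` (chain rule). [folklore] -/
theorem fderiv_prodFun_apply (hh : ContDiff ℝ 1 h) (v w : ℝ × (Fin m → ℝ)) :
    fderiv ℝ (prodFun h) v w = fderiv ℝ h (Fin.cons v.1 v.2) (Fin.cons w.1 w.2) := by
  have hd : HasFDerivAt (prodFun h) ((fderiv ℝ h (Fin.cons v.1 v.2)).comp (consCLM m)) v := by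
    have hh' : HasFDerivAt h (fderiv ℝ h (consCLM m v)) (consCLM m v) :=
      ((hh.differentiable one_ne_zero) _).hasFDerivAt
    exact hh'.comp v (consCLM m).hasFDerivAt
  rw [hd.fderiv]
  rfl

/-- The matrix of the partial derivative `∂(prodSys g)/∂y` is the tail Jacobian
`∂(g₁, …, gₘ)/∂(x₂, …, xₘ₊₁)`. [folklore] -/
theorem toMatrix'_fderiv_prodSys_inr (hg : ∀ i, ContDiff ℝ 1 (g i)) (v : ℝ × (Fin m → ℝ)) :
    LinearMap.toMatrix' ((fderiv ℝ (prodSys g) v ∘L ContinuousLinearMap.inr ℝ ℝ (Fin m → ℝ)) :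
      (Fin m → ℝ) →ₗ[ℝ] (Fin m → ℝ)) = tailJacobian g (Fin.cons v.1 v.2) := by
  ext i j
  rw [LinearMap.toMatrix'_apply, tailJacobian, Matrix.of_apply, ContinuousLinearMap.coe_coe,
    ContinuousLinearMap.comp_apply, ContinuousLinearMap.inr_apply, fderiv_prodSys_apply hg,
    cons_zero_single]

/-- The partial derivative `∂(prodSys g)/∂y` acts as the tail Jacobian matrix. [folklore] -/
theorem fderiv_prodSys_inr_apply (hg : ∀ i, ContDiff ℝ 1 (g i)) (v : ℝ × (Fin m → ℝ))
    (y : Fin m → ℝ) :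
    (fderiv ℝ (prodSys g) v ∘L ContinuousLinearMap.inr ℝ ℝ (Fin m → ℝ)) y =
      tailJacobian g (Fin.cons v.1 v.2) *ᵥ y := by
  rw [← toMatrix'_fderiv_prodSys_inr hg v, ← Matrix.toLin'_apply, Matrix.toLin'_toMatrix']
  rfl

/-- **Regularity in product form**: if `det ∂(g₁, …, gₘ)/∂(x₂, …, xₘ₊₁) ≠ 0` on `V` then
`prodSys g` is a regular system (`ImplicitCurve.IsRegular`). [folklore] -/
theorem isRegular_prodSys (hg : ∀ i, ContDiff ℝ 1 (g i))
    (hdet : ∀ x ∈ zeroLocus g, (tailJacobian g x).det ≠ 0) :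
    ImplicitCurve.IsRegular (prodSys g) := by
  refine ⟨contDiff_prodSys hg, fun v hv => ?_⟩
  set L : (Fin m → ℝ) →ₗ[ℝ] (Fin m → ℝ) :=
    ((fderiv ℝ (prodSys g) v ∘L ContinuousLinearMap.inr ℝ ℝ (Fin m → ℝ)) :
      (Fin m → ℝ) →ₗ[ℝ] (Fin m → ℝ)) with hL
  have hx : (Fin.cons v.1 v.2 : Fin (m + 1) → ℝ) ∈ zeroLocus g := (prodSys_eq_zero_iff v).1 hv
  have hunit :
      IsUnit (LinearMap.toMatrix (Pi.basisFun ℝ (Fin m)) (Pi.basisFun ℝ (Fin m)) L).det := by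
    rw [LinearMap.toMatrix_eq_toMatrix', hL, toMatrix'_fderiv_prodSys_inr hg v]
    exact isUnit_iff_ne_zero.2 (hdet _ hx)
  refine ⟨(LinearEquiv.ofIsUnitDet hunit).toContinuousLinearEquiv, ?_⟩
  ext y
  rfl

/-- The inverse of `∂(prodSys g)/∂y` acts as the inverse tail Jacobian matrix. [folklore] -/
theorem inverse_fderiv_prodSys_inr_apply (hg : ∀ i, ContDiff ℝ 1 (g i)) (v : ℝ × (Fin m → ℝ))
    (hdet : (tailJacobian g (Fin.cons v.1 v.2)).det ≠ 0) (z : Fin m → ℝ) :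
    (fderiv ℝ (prodSys g) v ∘L ContinuousLinearMap.inr ℝ ℝ (Fin m → ℝ)).inverse z =
      (tailJacobian g (Fin.cons v.1 v.2))⁻¹ *ᵥ z := by
  set D := tailJacobian g (Fin.cons v.1 v.2) with hD
  have hu : IsUnit D.det := isUnit_iff_ne_zero.2 hdet
  set Linv : (Fin m → ℝ) →L[ℝ] (Fin m → ℝ) :=
    LinearMap.toContinuousLinearMap (Matrix.toLin' D⁻¹) with hLinv
  have h1 : (fderiv ℝ (prodSys g) v ∘L ContinuousLinearMap.inr ℝ ℝ (Fin m → ℝ)) ∘L Linv =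
      ContinuousLinearMap.id ℝ _ := by
    ext1 y
    rw [ContinuousLinearMap.comp_apply, fderiv_prodSys_inr_apply hg, ← hD]
    simp [Linv, Matrix.mulVec_mulVec, Matrix.mul_nonsing_inv _ hu]
  have h2 : Linv ∘L (fderiv ℝ (prodSys g) v ∘L ContinuousLinearMap.inr ℝ ℝ (Fin m → ℝ)) =
      ContinuousLinearMap.id ℝ _ := by
    ext1 y
    rw [ContinuousLinearMap.comp_apply, fderiv_prodSys_inr_apply hg, ← hD]
    simp [Linv, Matrix.mulVec_mulVec, Matrix.nonsing_inv_mul _ hu]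
  rw [ContinuousLinearMap.inverse_eq h1 h2]
  simp [Linv]

/-! #### `g*` is the derivative along the branches -/

/-- A linear functional on `ℝ^{m+1}` evaluated through the coordinates. [folklore] -/
theorem clm_apply_eq_sum (φ : (Fin (m + 1) → ℝ) →L[ℝ] ℝ) (ξ : Fin (m + 1) → ℝ) :
    φ ξ = ∑ l, φ (Pi.single l 1) * ξ l := by
  conv_lhs => rw [pi_eq_sum_univ' ξ]
  rw [map_sum]
  refine Finset.sum_congr rfl fun l _ => ?_
  rw [map_smul, smul_eq_mul, mul_comm]

/-- **Column reduction**: if `M ξ` has only its first entry nonzero and `ξ₁ = 1`, then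
`det M = (M ξ)₁ · det M₁₁` (`M₁₁` the minor of the first row and column). [folklore] -/
theorem det_eq_mulVec_zero_mul_det_submatrix (M : Matrix (Fin (m + 1)) (Fin (m + 1)) ℝ)
    (ξ : Fin (m + 1) → ℝ) (hξ : ξ 0 = 1) (hM : ∀ i : Fin m, (M *ᵥ ξ) i.succ = 0) :
    M.det = (M *ᵥ ξ) 0 * (M.submatrix Fin.succ Fin.succ).det := by
  -- the column operation matrix `T = [ξ | e₂ | ⋯ | eₘ₊₁]`
  let T : Matrix (Fin (m + 1)) (Fin (m + 1)) ℝ := (1 : Matrix _ _ ℝ).updateCol 0 ξ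
  have hT : T.det = 1 := by
    have htri : T.BlockTriangular OrderDual.toDual := by
      intro i j hij
      have hij' : i < j := hij
      have hj : j ≠ 0 := fun h => by rw [h] at hij'; exact (Fin.not_lt_zero _ hij' : False)
      simp [T, Matrix.updateCol_ne hj, Matrix.one_apply_ne hij'.ne]
    rw [Matrix.det_of_lowerTriangular T htri, Fin.prod_univ_succ]
    have h0 : T 0 0 = 1 := by simp [T, hξ]
    have hs : ∀ i : Fin m, T i.succ i.succ = 1 := fun i => by
      simp [T]
    simp [h0, hs]
  have hMT : M * T = Matrix.of fun i j => if j = 0 then (M *ᵥ ξ) i else M i j := by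
    ext i j
    by_cases hj : j = 0
    · subst hj
      simp [T, Matrix.mul_apply, Matrix.mulVec, dotProduct, Matrix.updateCol_self]
    · simp [T, Matrix.mul_apply, Matrix.one_apply, hj]
  have hdet : (M * T).det = (M *ᵥ ξ) 0 * (M.submatrix Fin.succ Fin.succ).det := by
    rw [Matrix.det_succ_column_zero, Fin.sum_univ_succ]
    have hzero : ∀ i : Fin m, (M * T) i.succ 0 = 0 := fun i => by rw [hMT]; simpa using hM i
    have hsub : (M * T).submatrix (Fin.succAbove 0) Fin.succ = M.submatrix Fin.succ Fin.succ := by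
      ext i j
      rw [hMT]
      simp [Matrix.submatrix, Fin.succ_ne_zero]
    have h00 : (M * T) 0 0 = (M *ᵥ ξ) 0 := by rw [hMT]; simp
    simp only [hzero, mul_zero, zero_mul, Finset.sum_const_zero, add_zero]
    rw [h00, hsub]
    simp
  rw [← hdet, Matrix.det_mul, hT, mul_one]

/-- **`g*` is the derivative of `g` along the branches** (Wilkie 1989, p. 402: "a calculation …
shows that `fᵢ'(t) = g*(t, φᵢ(t))`"): at a point where `det ∂(g₁…gₘ)/∂(x₂…xₘ₊₁) ≠ 0`, Wilkie's
quotient of Jacobian determinants `gStar g h` equals `ImplicitCurve.star` of the product forms,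
i.e. `∂h/∂x₁ - ∂h/∂y · (∂g/∂y)⁻¹ · ∂g/∂x₁` (Schur complement). [cite: Wilkie1989, proof of Lemma 6, p. 402] -/
theorem gStar_eq_star (hg : ∀ i, ContDiff ℝ 1 (g i)) (hh : ContDiff ℝ 1 h)
    (v : ℝ × (Fin m → ℝ)) (hdet : (tailJacobian g (Fin.cons v.1 v.2)).det ≠ 0) :
    gStar g h (Fin.cons v.1 v.2) = ImplicitCurve.star (prodSys g) (prodFun h) v := by
  set x : Fin (m + 1) → ℝ := Fin.cons v.1 v.2 with hx
  set D := tailJacobian g x with hD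
  set s := tangentSlope (prodSys g) v with hs
  set ξ : Fin (m + 1) → ℝ := Fin.cons 1 s with hξ
  -- the slope solves `∂g/∂x₁ + (∂g/∂y) s = 0`
  have hc : fderiv ℝ (prodSys g) v (1, 0) = fun i => fderiv ℝ (g i) x (Pi.single 0 1) := by
    funext i
    rw [fderiv_prodSys_apply hg, cons_one_zero]
  have hslope : D *ᵥ s = -fun i => fderiv ℝ (g i) x (Pi.single 0 1) := by
    have hu : IsUnit D.det := isUnit_iff_ne_zero.2 hdet
    rw [hs, tangentSlope, Matrix.mulVec_neg, inverse_fderiv_prodSys_inr_apply hg v hdet, hc,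
      Matrix.mulVec_mulVec, Matrix.mul_nonsing_inv _ hu, Matrix.one_mulVec]
  -- row `i + 1` of `M ξ` vanishes, row `0` is `star`
  have hrow : ∀ i : Fin m, (fullJacobian g h x *ᵥ ξ) i.succ = 0 := by
    intro i
    have h1 : (fullJacobian g h x *ᵥ ξ) i.succ = fderiv ℝ (g i) x ξ := by
      rw [clm_apply_eq_sum]
      simp [Matrix.mulVec, dotProduct, fullJacobian]
    have h2 : fderiv ℝ (g i) x ξ = fderiv ℝ (g i) x (Pi.single 0 1) + (D *ᵥ s) i := by
      have e : ξ = Fin.cons 1 (0 : Fin m → ℝ) + Fin.cons 0 s := by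
        rw [hξ]; ext k; refine Fin.cases ?_ (fun j => ?_) k <;> simp
      have hDs : (D *ᵥ s) i = fderiv ℝ (g i) x (Fin.cons 0 s) := by
        have := congrFun (fderiv_prodSys_inr_apply hg v s) i
        rw [ContinuousLinearMap.comp_apply, ContinuousLinearMap.inr_apply,
          fderiv_prodSys_apply hg] at this
        exact this.symm
      rw [e, map_add, cons_one_zero, hDs]
    rw [h1, h2, hslope]
    simp
  have hrow0 : (fullJacobian g h x *ᵥ ξ) 0 = ImplicitCurve.star (prodSys g) (prodFun h) v := by
    rw [ImplicitCurve.star, fderiv_prodFun_apply hh, clm_apply_eq_sum]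
    simp [Matrix.mulVec, dotProduct, fullJacobian, hξ, hs, hx]
  have hsub : (fullJacobian g h x).submatrix Fin.succ Fin.succ = D := by
    ext i j
    simp [fullJacobian, hD, tailJacobian]
  have hdetM := det_eq_mulVec_zero_mul_det_submatrix (fullJacobian g h x) ξ (by simp [hξ]) hrow
  rw [gStar, hdetM, hrow0, hsub, mul_assoc, mul_inv_cancel₀ hdet, mul_one]

/-! #### Fibres -/

/-- The fibre of `V` over `x₁ = a` within `S` is the image of `{y ∈ S : (a, y) ∈ V}` under
`y ↦ (a, y)`. [folklore] -/
theorem fibre_eq_image (a : ℝ) (S : Set (Fin m → ℝ)) :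
    fibre (zeroLocus g) a S =
      (fun y => (Fin.cons a y : Fin (m + 1) → ℝ)) '' {y | prodSys g (a, y) = 0 ∧ y ∈ S} := by
  ext x
  constructor
  · rintro ⟨hxV, hx0, hxS⟩
    refine ⟨Fin.tail x, ⟨?_, hxS⟩, ?_⟩
    · rw [prodSys_eq_zero_iff]
      simpa [← hx0, Fin.cons_self_tail] using hxV
    · simp [← hx0, Fin.cons_self_tail]
  · rintro ⟨y, ⟨hy, hyS⟩, rfl⟩
    exact ⟨(prodSys_eq_zero_iff (a, y)).1 hy, by simp, by simpa using hyS⟩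

/-- The fibre has as many points as `{y ∈ S : (a, y) ∈ V}`. [folklore] -/
theorem encard_fibre (a : ℝ) (S : Set (Fin m → ℝ)) :
    (fibre (zeroLocus g) a S).encard = {y | prodSys g (a, y) = 0 ∧ y ∈ S}.encard := by
  rw [fibre_eq_image, Function.Injective.encard_image]
  exact fun y₁ y₂ h => (Fin.cons_injective2 h).2

/-! #### Lemma 4 -/

/-- **Wilkie 1989, Lemma 4, in coordinates** (pp. 399–400; the reading of
`Wilkie1989Curves.lean`): `g₁, …, gₘ : ℝ^{m+1} → ℝ` of class `C¹` with
`det ∂(g₁, …, gₘ)/∂(x₂, …, xₘ₊₁) ≠ 0` on `V = zeroLocus g`; `0 < B`, `|β₁| < B`, `1 ≤ r`;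
the fibre of `V` over `β₁` in the closed box `Ū_{B+1}` lies in the open box `U_B` and has
exactly `r` points (the printed hypothesis `V ∩ ({β₁} × U_B) = V ∩ ({β₁} × U_{B+2})` implies
this).  Then there are `-B ≤ c < β₁ < d ≤ B` such that every fibre over `a ∈ [c, d]` in `Ū_B`
has exactly `r` points, over `a ∈ {c, d}` some point of `V` has sup norm `B` or `B + 1`, and
over `a ∈ (c, d)` every point of `V` has sup norm `< B` or `> B + 1`.  The printed hypothesis
"`V` is the union of finitely many connected components" is not needed
(`ImplicitCurve.lemma4`). [cite: Wilkie1989, Lemma 4] -/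
theorem _root_.Literature.ModelTheory.ExponentialFields.Wilkie1989_lemma4
    (hg : ∀ i, ContDiff ℝ 1 (g i))
    (hdet : ∀ x ∈ zeroLocus g, (tailJacobian g x).det ≠ 0) {B β₁ : ℝ} (hB : 0 < B)
    (hβ : |β₁| < B) {r : ℕ} (hr : 1 ≤ r)
    (hgap : fibre (zeroLocus g) β₁ (closure (box (B + 1))) ⊆ fibre (zeroLocus g) β₁ (box B))
    (hcount : (fibre (zeroLocus g) β₁ (box B)).encard = r) :
    ∃ c d, -B ≤ c ∧ c < β₁ ∧ β₁ < d ∧ d ≤ B ∧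
      (∀ a ∈ Icc c d, (fibre (zeroLocus g) a (closure (box B))).encard = r) ∧
      (∀ a, a = c ∨ a = d → ∃ x ∈ zeroLocus g, x 0 = a ∧ (‖x‖ = B ∨ ‖x‖ = B + 1)) ∧
      (∀ a ∈ Ioo c d, ∀ x ∈ zeroLocus g, x 0 = a → ‖x‖ < B ∨ B + 1 < ‖x‖) := by
  have hreg := isRegular_prodSys hg hdet
  have hB1 : (0 : ℝ) < B + 1 := by linarith
  -- the slice over `β₁` in product form
  have hS : {z | prodSys g (β₁, z) = 0 ∧ ‖z‖ < B} = {y | prodSys g (β₁, y) = 0 ∧ y ∈ box B} := by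
    ext z; simp only [mem_setOf_eq, mem_box_iff_norm_lt hB]
  have hcount' : {z | prodSys g (β₁, z) = 0 ∧ ‖z‖ < B}.encard = r := by
    rw [hS, ← encard_fibre, hcount]
  obtain ⟨y, hy⟩ := exists_embedding_of_encard_eq hcount'
  have hmem : ∀ i, y i ∈ {z | prodSys g (β₁, z) = 0 ∧ ‖z‖ < B} := fun i => hy ▸ mem_range_self i
  have hyV : ∀ i, prodSys g (β₁, y i) = 0 := fun i => (hmem i).1
  have hyB : ∀ i, ‖y i‖ < B := fun i => (hmem i).2
  have hgap' : ∀ z, prodSys g (β₁, z) = 0 → ‖z‖ ≤ B + 1 → ∃ i, z = y i := by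
    intro z hz hzB
    have hzf : (Fin.cons β₁ z : Fin (m + 1) → ℝ) ∈
        fibre (zeroLocus g) β₁ (closure (box (B + 1))) :=
      ⟨(prodSys_eq_zero_iff (β₁, z)).1 hz, by simp, by
        simpa [mem_closure_box_iff_norm_le hB1] using hzB⟩
    have hzb := hgap hzf
    have hzB' : ‖z‖ < B := by
      have := hzb.2.2
      simpa [mem_box_iff_norm_lt hB] using this
    have hmem' : z ∈ range y := by rw [hy]; exact ⟨hz, hzB'⟩
    obtain ⟨i, rfl⟩ := hmem'
    exact ⟨i, rfl⟩
  have hβB : β₁ < B := (abs_lt.1 hβ).2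
  have hBβ : -B < β₁ := (abs_lt.1 hβ).1
  obtain ⟨d, hβd, hdB, hcd, hed, hgd⟩ :=
    lemma4_right hreg hyV y.injective hβB hBβ hr hyB hgap'
  obtain ⟨c, hcβ, hBc, hcc, hec, hgc⟩ :=
    lemma4_left hreg hyV y.injective hβB hBβ hr hyB hgap'
  -- translate back
  have hcountI : ∀ a, {z | prodSys g (a, z) = 0 ∧ ‖z‖ ≤ B}.encard = r →
      (fibre (zeroLocus g) a (closure (box B))).encard = r := by
    intro a ha
    rw [encard_fibre, ← ha]
    congr 1
    ext z
    simp only [mem_setOf_eq, mem_closure_box_iff_norm_le hB]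
  have hend : ∀ a, (∃ z, prodSys g (a, z) = 0 ∧ (‖(a, z)‖ = B ∨ ‖(a, z)‖ = B + 1)) →
      ∃ x ∈ zeroLocus g, x 0 = a ∧ (‖x‖ = B ∨ ‖x‖ = B + 1) := by
    rintro a ⟨z, hz, hzB⟩
    exact ⟨Fin.cons a z, (prodSys_eq_zero_iff (a, z)).1 hz, by simp, by rwa [norm_cons]⟩
  have hgapI : ∀ a, (∀ z, prodSys g (a, z) = 0 → ‖(a, z)‖ < B ∨ B + 1 < ‖(a, z)‖) →
      ∀ x ∈ zeroLocus g, x 0 = a → ‖x‖ < B ∨ B + 1 < ‖x‖ := by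
    intro a ha x hx hx0
    have h := ha (Fin.tail x) ((prodSys_eq_zero_iff (a, Fin.tail x)).2 (by
      simpa [← hx0, Fin.cons_self_tail] using hx))
    rwa [← norm_cons, ← hx0, Fin.cons_self_tail] at h
  refine ⟨c, d, hBc, hcβ, hβd, hdB, fun a ha => ?_, ?_, fun a ha => ?_⟩
  · rcases le_total a β₁ with h | h
    · exact hcountI a (hcc a ⟨ha.1, h⟩)
    · exact hcountI a (hcd a ⟨h, ha.2⟩)
  · rintro a (rfl | rfl)
    · exact hend _ hec
    · exact hend _ hed
  · rcases lt_or_ge a β₁ with h | h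
    · exact hgapI a (hgc a ⟨ha.1, h.le⟩)
    · exact hgapI a (hgd a ⟨h, ha.2⟩)

/-! #### Lemma 6 -/

/-- **Wilkie 1989, Lemma 6, in coordinates** (pp. 401–402; the notation of
`Wilkie1989Curves.lean`, with `gStar`): `g₁, …, gₘ : ℝ^{m+1} → ℝ` of class `C¹` with
`det ∂(g₁, …, gₘ)/∂(x₂, …, xₘ₊₁) ≠ 0` on `V = zeroLocus g`; `0 < B`, `c < d`; every fibre of
`V` over `a ∈ [c, d]` in `Ū_B` has exactly `r` points, and for `a ∈ (c, d)` these lie in `U_B`;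
`h` (Wilkie's `g`) of class `C¹` with `g* = gStar g h ≠ 0` on `V ∩ ([c, d] × Ū_B)`.  Then
`#{x ∈ V : x₁ ∈ [c, d], (x₂…) ∈ Ū_B, h(x) = 0} + #S(c)(+,+) + #S(c)(-,-) + #S(d)(+,-) + #S(d)(-,+)
= r`, `S(a)(σ, τ) = {x ∈ V ∩ ({a} × Ū_B) : h(x) σ 0, g*(x) τ 0}` (the printed hypotheses
`-B < c`, `d < B`, `r ≥ 1`, `g* ≠ 0` on all of `V` are not needed). [cite: Wilkie1989, Lemma 6] -/
theorem _root_.Literature.ModelTheory.ExponentialFields.Wilkie1989_lemma6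
    (hg : ∀ i, ContDiff ℝ 1 (g i))
    (hdet : ∀ x ∈ zeroLocus g, (tailJacobian g x).det ≠ 0) (hh : ContDiff ℝ 1 h)
    {B c d : ℝ} (hB : 0 < B) (hcd : c < d) {r : ℕ}
    (hcount : ∀ a ∈ Icc c d, (fibre (zeroLocus g) a (closure (box B))).encard = r)
    (hbox : ∀ a ∈ Ioo c d, fibre (zeroLocus g) a (closure (box B)) ⊆ fibre (zeroLocus g) a (box B))
    (hstar : ∀ x ∈ zeroLocus g, x 0 ∈ Icc c d → Fin.tail x ∈ closure (box B) → gStar g h x ≠ 0) :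
    {x | x ∈ zeroLocus g ∧ x 0 ∈ Icc c d ∧ Fin.tail x ∈ closure (box B) ∧ h x = 0}.encard
      + {x ∈ fibre (zeroLocus g) c (closure (box B)) | 0 < h x ∧ 0 < gStar g h x}.encard
      + {x ∈ fibre (zeroLocus g) c (closure (box B)) | h x < 0 ∧ gStar g h x < 0}.encard
      + {x ∈ fibre (zeroLocus g) d (closure (box B)) | 0 < h x ∧ gStar g h x < 0}.encard
      + {x ∈ fibre (zeroLocus g) d (closure (box B)) | h x < 0 ∧ 0 < gStar g h x}.encard = r := by
  have hreg := isRegular_prodSys hg hdet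
  have hcount' : ∀ a ∈ Icc c d, {z | prodSys g (a, z) = 0 ∧ ‖z‖ ≤ B}.encard = r := by
    intro a ha
    rw [← hcount a ha, encard_fibre]
    congr 1
    ext z
    simp only [mem_setOf_eq, mem_closure_box_iff_norm_le hB]
  have hbox' : ∀ a ∈ Ioo c d, ∀ z, prodSys g (a, z) = 0 → ‖z‖ ≤ B → ‖z‖ < B := by
    intro a ha z hz hzB
    have hzf : (Fin.cons a z : Fin (m + 1) → ℝ) ∈ fibre (zeroLocus g) a (closure (box B)) :=
      ⟨(prodSys_eq_zero_iff (a, z)).1 hz, by simp, by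
        simpa [mem_closure_box_iff_norm_le hB] using hzB⟩
    have := (hbox a ha hzf).2.2
    simpa [mem_box_iff_norm_lt hB] using this
  -- `star = gStar` on `V ∩ ([c, d] × Ū_B)`
  have hstar_eq : ∀ v : ℝ × (Fin m → ℝ), prodSys g v = 0 →
      ImplicitCurve.star (prodSys g) (prodFun h) v = gStar g h (Fin.cons v.1 v.2) := fun v hv =>
    (gStar_eq_star hg hh v (hdet _ ((prodSys_eq_zero_iff v).1 hv))).symm
  have hstar' : ∀ v, prodSys g v = 0 → v.1 ∈ Icc c d → ‖v.2‖ ≤ B →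
      ImplicitCurve.star (prodSys g) (prodFun h) v ≠ 0 := by
    intro v hv hv1 hv2
    rw [hstar_eq v hv]
    exact hstar _ ((prodSys_eq_zero_iff v).1 hv) (by simpa using hv1)
      (by simpa [mem_closure_box_iff_norm_le hB] using hv2)
  have h6 := ImplicitCurve.lemma6 hreg (contDiff_prodFun hh) hcd hcount' hbox' hstar'
  -- translate the five sets
  have hZ : {x | x ∈ zeroLocus g ∧ x 0 ∈ Icc c d ∧ Fin.tail x ∈ closure (box B) ∧ h x = 0} =
      consCLM m '' {v : ℝ × (Fin m → ℝ) | prodSys g v = 0 ∧ v.1 ∈ Icc c d ∧ ‖v.2‖ ≤ B ∧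
        prodFun h v = 0} := by
    ext x
    constructor
    · rintro ⟨hxV, hx0, hxB, hxh⟩
      refine ⟨(x 0, Fin.tail x), ⟨?_, hx0, ?_, ?_⟩, ?_⟩
      · rw [prodSys_eq_zero_iff]; simpa [Fin.cons_self_tail] using hxV
      · simpa [mem_closure_box_iff_norm_le hB] using hxB
      · simpa [Fin.cons_self_tail] using hxh
      · simp [Fin.cons_self_tail]
    · rintro ⟨v, ⟨hv, hv1, hv2, hvh⟩, rfl⟩
      exact ⟨(prodSys_eq_zero_iff v).1 hv, by simpa using hv1,
        by simpa [mem_closure_box_iff_norm_le hB] using hv2, by simpa using hvh⟩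
  have hSgen : ∀ a : ℝ, ∀ P : ℝ → ℝ → Prop,
      {x ∈ fibre (zeroLocus g) a (closure (box B)) | P (h x) (gStar g h x)} =
        consCLM m '' {v : ℝ × (Fin m → ℝ) | v.1 = a ∧ prodSys g v = 0 ∧ ‖v.2‖ ≤ B ∧
          P (prodFun h v) (ImplicitCurve.star (prodSys g) (prodFun h) v)} := by
    intro a P
    ext x
    constructor
    · rintro ⟨⟨hxV, hx0, hxB⟩, hP⟩
      have hv : prodSys g (x 0, Fin.tail x) = 0 := by
        rw [prodSys_eq_zero_iff]; simpa [Fin.cons_self_tail] using hxV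
      refine ⟨(x 0, Fin.tail x), ⟨hx0, hv, ?_, ?_⟩, ?_⟩
      · simpa [mem_closure_box_iff_norm_le hB] using hxB
      · rw [hstar_eq _ hv]; simpa [Fin.cons_self_tail] using hP
      · simp [Fin.cons_self_tail]
    · rintro ⟨v, ⟨hv1, hv, hv2, hP⟩, rfl⟩
      refine ⟨⟨(prodSys_eq_zero_iff v).1 hv, by simpa using hv1,
        by simpa [mem_closure_box_iff_norm_le hB] using hv2⟩, ?_⟩
      rw [hstar_eq _ hv] at hP
      simpa using hP
  have hinj : Function.Injective (consCLM m) := fun p q hpq => by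
    simp only [consCLM_apply, Fin.cons_inj] at hpq
    exact Prod.ext hpq.1 hpq.2
  have hslice : ∀ a : ℝ, ∀ P : ℝ → ℝ → Prop,
      {v : ℝ × (Fin m → ℝ) | v.1 = a ∧ prodSys g v = 0 ∧ ‖v.2‖ ≤ B ∧
          P (prodFun h v) (ImplicitCurve.star (prodSys g) (prodFun h) v)}.encard =
        {z | prodSys g (a, z) = 0 ∧ ‖z‖ ≤ B ∧
          P (prodFun h (a, z)) (ImplicitCurve.star (prodSys g) (prodFun h) (a, z))}.encard := by
    intro a P
    have : {v : ℝ × (Fin m → ℝ) | v.1 = a ∧ prodSys g v = 0 ∧ ‖v.2‖ ≤ B ∧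
        P (prodFun h v) (ImplicitCurve.star (prodSys g) (prodFun h) v)} =
        (fun z => (a, z)) '' {z | prodSys g (a, z) = 0 ∧ ‖z‖ ≤ B ∧
          P (prodFun h (a, z)) (ImplicitCurve.star (prodSys g) (prodFun h) (a, z))} := by
      ext ⟨t, z⟩
      constructor
      · rintro ⟨rfl, hv, hvB, hP⟩
        exact ⟨z, ⟨hv, hvB, hP⟩, rfl⟩
      · rintro ⟨z', hz', hzv⟩
        simp only [Prod.mk.injEq] at hzv
        obtain ⟨rfl, rfl⟩ := hzv
        exact ⟨rfl, hz'⟩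
    rw [this, Function.Injective.encard_image]
    exact fun z₁ z₂ hz => (Prod.ext_iff.1 hz).2
  rw [hZ, hinj.encard_image,
    hSgen c (fun p q => 0 < p ∧ 0 < q), hinj.encard_image, hslice c (fun p q => 0 < p ∧ 0 < q),
    hSgen c (fun p q => p < 0 ∧ q < 0), hinj.encard_image, hslice c (fun p q => p < 0 ∧ q < 0),
    hSgen d (fun p q => 0 < p ∧ q < 0), hinj.encard_image, hslice d (fun p q => 0 < p ∧ q < 0),
    hSgen d (fun p q => p < 0 ∧ 0 < q), hinj.encard_image, hslice d (fun p q => p < 0 ∧ 0 < q)]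
  exact h6

end SpaceCurve

end Literature.ModelTheory.ExponentialFields
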